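import Literature.Computability.FineGrained.IPRenameTheta
import HarnessLib

/-!
# The renaming machine of Impagliazzo–Paturi's Lemma 2, VIII: building the dependency lists in the tuple register

Family `fine-grained` (trunk T-CPLX-FINE). Eighth file of the machine half of Impagliazzo–Paturi's Lemma 2. Before the emission loop of
`IPRenameTruthTable.lean` runs for a clause `c` (resp. a block `i`), the tuple register `vt` must
hold the dependency variables `depClause P F c` (resp. `depTheta P F i`) of
`ForcedVariableRenaming.lean` with the all-false tuple. This file builds that content from the
annotated clause and the tables.

* `vEmitBlock` / **`runs_vEmitBlock`** — one pass over a copy of the block table writing the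
  literals of block `blk`, each with polarity `false`, onto the staging register `tmp`
  (`depW`, `depW_eq`: this is the clause body of `depTheta` by `depTheta_eq`);
* `yEmit` / **`runs_yEmit`** — one pass over a copy of the `Y`-table writing the index tokens of
  block `iu2` as literals of polarity `false` (`yLitW`);
* `vbBody` / `vBuild` / **`runs_vBuild`** — scan of the annotated clause: an `A`-literal
  contributes its own literal, a `B`-literal the two words above of its block; then `tmp` is
  poured into `vt` (`alDepW`, `vdepW`); **`vdepW_eq`**: for the annotation of a clause `c` of `F`
  and the tables of `P`, `F` the result is `cbody ((depClause P F c).map (·, false))`, i.e. the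
  literal list `V.zip (replicate |V| false)` the emission loop starts from (`zip_replicate_false`).

## References

* R. Impagliazzo, R. Paturi, *On the complexity of k-SAT*, J. Comput. System Sci. 62 (2001)
  367–375, doi:10.1006/jcss.2000.1727, Lemma 2 (p. 373) and its "Moreover" sentence (the
  reduction is computable within the stated time); pp. 371–372 (`G_x`, `Ψ`, `Θ_i`, `Φ_f`).
  (Not held; acquisition request acq-00143.)
* T. Nipkow, G. Klein, *Concrete Semantics with Isabelle/HOL*, Springer 2014, Ch. 7 (big-step
  reasoning about loops, as in `SymbolPrograms.lean`).
-/

namespace Literature.Computability.FineGrained.IPRenameM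

open _root_.Computability Complexity Complexity.ACom Sparsifier IPRename

/-! ### Writing the dependency list of a block into the tuple register: programs -/

/-- Emit a symbol onto the staging register `tmp` of the emission bank. [folklore] -/
abbrev emit (s : Γ') : RProg := push (tb TB.tmp) s

/-- Body of the pass writing the literals of block `blk` of the block table (copy in `btw`) onto
`tmp`, each with polarity `false`: modes in `md2` as in the block pass (`bra` skip, nothing =
variable/entry start, `bit false`/`bit true` = pattern flags, `comma` = literal start, `ket` =
inside a literal, `blank` = done). [folklore] -/
def veBody (s : Γ') : RProg :=
  pop (kr KR.md2) fun o => match o, s with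
    | none, Γ'.bit _ => push (kr KR.md2) (Γ'.bit false)
    | none, Γ'.bra => skip
    | none, Γ'.blank => push (kr KR.md2) Γ'.blank
    | some (Γ'.bit false), Γ'.bit _ => push (kr KR.md2) (Γ'.bit true)
    | some (Γ'.bit true), Γ'.comma => push (kr KR.md2) Γ'.comma
    | some Γ'.comma, Γ'.bit _ => emit (Γ'.bit false) ;; push (kr KR.md2) Γ'.ket
    | some Γ'.comma, Γ'.ket => skip
    | some Γ'.ket, Γ'.bit d => emit (Γ'.bit d) ;; push (kr KR.md2) Γ'.ket
    | some Γ'.ket, Γ'.comma => emit Γ'.comma ;; push (kr KR.md2) Γ'.comma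
    | some Γ'.bra, Γ'.blank => pop (kr KR.blk) fun _ => ifTop (kr KR.blk) fun o' => match o' with
        | some _ => push (kr KR.md2) Γ'.bra
        | none => skip
    | some Γ'.bra, _ => push (kr KR.md2) Γ'.bra
    | some Γ'.blank, _ => push (kr KR.md2) Γ'.blank
    | _, _ => skip

/-- `vEmitBlock`: push onto `tmp` (reversed) the literals `(v, false)` for the variables `v` of
`depTheta` of block `blk` (ticks; emptied), read off a fresh copy of the block table. [folklore] -/
def vEmitBlock : RProg :=
  copyToG (kr KR.bt) (kr KR.btw) (kr KR.t1) (kr KR.t2) ;;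
  (ifTop (kr KR.blk) fun o => match o with
    | some _ => push (kr KR.md2) Γ'.bra
    | none => skip) ;;
  loop (kr KR.btw) veBody ;; clear (kr KR.md2)

/-- The word of the dependency literals of a list of variable tables: for each table, each
entry, each literal, the literal `(new index, false)`. [folklore] -/
def depW (zss : List (List Entry)) : List Γ' :=
  zss.flatMap fun es => es.flatMap fun e => e.lits.flatMap fun l => KCNF.encodeLiteral (l.1, false)

/-- `depW` is the clause body of the dependency variables with polarity `false`. [folklore] -/
theorem depW_eq (zss : List (List Entry)) :
    depW zss = cbody ((zss.flatMap fun es => es.flatMap fun e => e.lits.map Prod.fst).map fun v => (v, false)) := by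
  unfold depW cbody
  simp [List.flatMap_map, List.map_flatMap, List.flatMap_assoc]

/-! ### Writing the dependency list of a block: store family and specifications -/

/-- The store during `vEmitBlock`: the copy `btw`, the mode `md2`, the staging register `tmp`.
[folklore] -/
def veSt (S : RStore) (btw md2 tmp : List Γ') : RStore := fun r =>
  if r = kr KR.btw then btw else if r = kr KR.md2 then md2 else if r = tb TB.tmp then tmp else S r

section VeSt

variable (S : RStore) (btw md2 tmp w : List Γ')

/-- Reading `btw`. [folklore] -/
@[simp] theorem veSt_btw : veSt S btw md2 tmp (kr KR.btw) = btw := by simp [veSt]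
/-- Reading `md2`. [folklore] -/
@[simp] theorem veSt_md2 : veSt S btw md2 tmp (kr KR.md2) = md2 := by simp [veSt]
/-- Reading `tmp`. [folklore] -/
@[simp] theorem veSt_tmp : veSt S btw md2 tmp (tb TB.tmp) = tmp := by simp [veSt]
/-- Reading any other register. [folklore] -/
theorem veSt_other {r : Reg} (h0 : r ≠ kr KR.btw) (h1 : r ≠ kr KR.md2) (h2 : r ≠ tb TB.tmp) :
    veSt S btw md2 tmp r = S r := by simp [veSt, h0, h1, h2]
/-- Reading `blk`. [folklore] -/
@[simp] theorem veSt_blk : veSt S btw md2 tmp (kr KR.blk) = S (kr KR.blk) := by simp [veSt]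
/-- Reading `bt`. [folklore] -/
@[simp] theorem veSt_bt : veSt S btw md2 tmp (kr KR.bt) = S (kr KR.bt) := by simp [veSt]
/-- Reading `t1`. [folklore] -/
@[simp] theorem veSt_t1 : veSt S btw md2 tmp (kr KR.t1) = S (kr KR.t1) := by simp [veSt]
/-- Reading `t2`. [folklore] -/
@[simp] theorem veSt_t2 : veSt S btw md2 tmp (kr KR.t2) = S (kr KR.t2) := by simp [veSt]
/-- Updating `btw`. [folklore] -/
@[simp] theorem update_veSt_btw : Function.update (veSt S btw md2 tmp) (kr KR.btw) w = veSt S w md2 tmp := by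
  funext r; by_cases h : r = kr KR.btw
  · subst h; simp
  · rw [Function.update_of_ne h]; simp [veSt, h]
/-- Updating `md2`. [folklore] -/
@[simp] theorem update_veSt_md2 : Function.update (veSt S btw md2 tmp) (kr KR.md2) w = veSt S btw w tmp := by
  funext r; by_cases h : r = kr KR.md2
  · subst h; simp
  · rw [Function.update_of_ne h]; simp [veSt, h]
/-- Updating `tmp`. [folklore] -/
@[simp] theorem update_veSt_tmp : Function.update (veSt S btw md2 tmp) (tb TB.tmp) w = veSt S btw md2 w := by
  funext r; by_cases h : r = tb TB.tmp
  · subst h; simp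
  · rw [Function.update_of_ne h]; simp [veSt, h]
/-- Updating `blk` commutes with the family. [folklore] -/
theorem update_veSt_blk (u : List Γ') :
    Function.update (veSt S btw md2 tmp) (kr KR.blk) u = veSt (Function.update S (kr KR.blk) u) btw md2 tmp := by
  funext r; by_cases h : r = kr KR.blk
  · subst h; simp [veSt]
  · rw [Function.update_of_ne h]; simp only [veSt, Function.update_of_ne h]

end VeSt

/-- Every store is a `veSt` over itself. [folklore] -/
theorem veSt_eta (R : RStore) : veSt R (R (kr KR.btw)) (R (kr KR.md2)) (R (tb TB.tmp)) = R := by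
  funext r
  by_cases h0 : r = kr KR.btw; · subst h0; simp
  by_cases h1 : r = kr KR.md2; · subst h1; simp
  by_cases h2 : r = tb TB.tmp; · subst h2; simp
  rw [veSt_other _ _ _ _ h0 h1 h2]

section VeSpec

variable (S : RStore)

/-- Inside a literal (mode `ket`): index bits are emitted. [folklore] -/
theorem segRuns_ve_bits : ∀ (u : List Bool) (rest tmp : List Γ'),
    SegRuns (kr KR.btw) veBody (u.map Γ'.bit) (veSt S (u.map Γ'.bit ++ rest) [Γ'.ket] tmp)
      (veSt S rest [Γ'.ket] ((u.map Γ'.bit).reverse ++ tmp)) (6 * u.length)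
  | [], rest, tmp => by simpa using SegRuns.nil (kr KR.btw) veBody _
  | d :: u, rest, tmp => by
    have hbody : Runs (veBody (Γ'.bit d)) (Function.update (veSt S (Γ'.bit d :: (u.map Γ'.bit ++ rest)) [Γ'.ket] tmp)
        (kr KR.btw) (u.map Γ'.bit ++ rest)) (veSt S (u.map Γ'.bit ++ rest) [Γ'.ket] (Γ'.bit d :: tmp)) (2 + 2) := by
      rw [update_veSt_btw]; unfold veBody
      refine Runs.pop_cons (k := kr KR.md2) (a := Γ'.ket) (w := []) (by simp) ?_
      rw [update_veSt_md2]
      exact ((Runs.push' (R' := veSt S (u.map Γ'.bit ++ rest) [] (Γ'.bit d :: tmp)) (by simp)).seq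
        (Runs.push' (by simp))).of_eq rfl (by norm_num)
    have ih := segRuns_ve_bits u rest (Γ'.bit d :: tmp)
    have hk : veSt S (Γ'.bit d :: (u.map Γ'.bit ++ rest)) [Γ'.ket] tmp (kr KR.btw) = Γ'.bit d :: (u.map Γ'.bit ++ rest) := by
      simp
    refine (SegRuns.cons hk hbody ih).cast (by simp) (by simp) (by simp) ?_
    simp only [List.length_cons]; omega

/-- **One literal of an entry** is emitted with polarity `false` (mode `comma` before and after).
[folklore] -/
theorem segRuns_ve_literal (l : Lit) (rest tmp : List Γ') :
    SegRuns (kr KR.btw) veBody (KCNF.encodeLiteral l) (veSt S (KCNF.encodeLiteral l ++ rest) [Γ'.comma] tmp)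
      (veSt S rest [Γ'.comma] ((KCNF.encodeLiteral (l.1, false)).reverse ++ tmp)) (10 * (KCNF.encodeLiteral l).length) := by
  obtain ⟨ν, q⟩ := l
  have hlit : ∀ b : Bool, KCNF.encodeLiteral (ν, b) = Γ'.bit b :: ((encodeNat ν).map Γ'.bit ++ [Γ'.comma]) := fun b => rfl
  rw [hlit q]
  simp only [hlit false]
  set u := (encodeNat ν).map Γ'.bit with hu
  have h1 : Runs (veBody (Γ'.bit q)) (Function.update (veSt S (Γ'.bit q :: (u ++ [Γ'.comma]) ++ rest) [Γ'.comma] tmp)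
      (kr KR.btw) (u ++ [Γ'.comma] ++ rest)) (veSt S (u ++ [Γ'.comma] ++ rest) [Γ'.ket] (Γ'.bit false :: tmp)) (2 + 2) := by
    rw [update_veSt_btw]; unfold veBody
    refine Runs.pop_cons (k := kr KR.md2) (a := Γ'.comma) (w := []) (by simp) ?_
    rw [update_veSt_md2]
    exact ((Runs.push' (R' := veSt S (u ++ [Γ'.comma] ++ rest) [] (Γ'.bit false :: tmp)) (by simp)).seq
      (Runs.push' (by simp))).of_eq rfl (by norm_num)
  have h2 := segRuns_ve_bits S (encodeNat ν) ([Γ'.comma] ++ rest) (Γ'.bit false :: tmp)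
  rw [← hu] at h2
  have h3 : Runs (veBody Γ'.comma) (Function.update (veSt S ([Γ'.comma] ++ rest) [Γ'.ket] (u.reverse ++ Γ'.bit false :: tmp))
      (kr KR.btw) rest) (veSt S rest [Γ'.comma] (Γ'.comma :: (u.reverse ++ Γ'.bit false :: tmp))) (2 + 2) := by
    rw [update_veSt_btw]; unfold veBody
    refine Runs.pop_cons (k := kr KR.md2) (a := Γ'.ket) (w := []) (by simp) ?_
    rw [update_veSt_md2]
    exact ((Runs.push' (R' := veSt S rest [] (Γ'.comma :: (u.reverse ++ Γ'.bit false :: tmp))) (by simp)).seq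
      (Runs.push' (by simp))).of_eq rfl (by norm_num)
  have hk1 : veSt S (Γ'.bit q :: (u ++ [Γ'.comma]) ++ rest) [Γ'.comma] tmp (kr KR.btw) = Γ'.bit q :: (u ++ [Γ'.comma] ++ rest) := by
    simp
  have hk3 : veSt S ([Γ'.comma] ++ rest) [Γ'.ket] (u.reverse ++ Γ'.bit false :: tmp) (kr KR.btw) = Γ'.comma :: rest := by
    simp
  have h23 := h2.append (SegRuns.single hk3 h3)
  have := SegRuns.cons hk1 h1 (h23.cast rfl (by simp) rfl le_rfl)
  refine this.cast (by simp) rfl (by simp) ?_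
  have : u.length = (encodeNat ν).length := by simp [hu]
  simp only [List.length_cons, List.length_append, List.length_nil]; omega

/-- **The literals of an entry.** [folklore] -/
theorem segRuns_ve_lits : ∀ (ls : List Lit) (rest tmp : List Γ'),
    SegRuns (kr KR.btw) veBody (cbody ls) (veSt S (cbody ls ++ rest) [Γ'.comma] tmp)
      (veSt S rest [Γ'.comma] ((ls.flatMap fun l => KCNF.encodeLiteral (l.1, false)).reverse ++ tmp))
      (10 * (cbody ls).length)
  | [], rest, tmp => by simpa using SegRuns.nil (kr KR.btw) veBody _
  | l :: ls, rest, tmp => by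
    have h1 := segRuns_ve_literal S l (cbody ls ++ rest) tmp
    have h2 := segRuns_ve_lits ls rest ((KCNF.encodeLiteral (l.1, false)).reverse ++ tmp)
    have := h1.append h2
    refine this.cast (by simp [cbody_cons, encodeLiteral_eq]) (by simp [cbody_cons, encodeLiteral_eq]) (by simp) ?_
    simp only [cbody_cons, encodeLiteral_eq, List.length_append, List.length_cons, List.length_nil]; ring_nf; omega

/-- **One entry**: its flag token is passed, its literals emitted (mode empty before and after).
[folklore] -/
theorem segRuns_ve_entry (e : Entry) (rest tmp : List Γ') :
    SegRuns (kr KR.btw) veBody (wEntry e) (veSt S (wEntry e ++ rest) [] tmp)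
      (veSt S rest [] ((e.lits.flatMap fun l => KCNF.encodeLiteral (l.1, false)).reverse ++ tmp)) (10 * (wEntry e).length) := by
  have hw : wEntry e = Γ'.bit e.pt :: Γ'.bit e.pf :: Γ'.comma :: (cbody e.lits ++ [Γ'.ket]) := rfl
  have h1 : Runs (veBody (Γ'.bit e.pt)) (Function.update (veSt S (wEntry e ++ rest) [] tmp) (kr KR.btw)
      (Γ'.bit e.pf :: Γ'.comma :: (cbody e.lits ++ [Γ'.ket]) ++ rest))
      (veSt S (Γ'.bit e.pf :: Γ'.comma :: (cbody e.lits ++ [Γ'.ket]) ++ rest) [Γ'.bit false] tmp) (1 + 2) := by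
    rw [update_veSt_btw]; unfold veBody
    exact Runs.pop_nil (by simp) (Runs.push' (by simp))
  have h2 : Runs (veBody (Γ'.bit e.pf)) (Function.update (veSt S (Γ'.bit e.pf :: Γ'.comma :: (cbody e.lits ++ [Γ'.ket]) ++ rest)
      [Γ'.bit false] tmp) (kr KR.btw) (Γ'.comma :: (cbody e.lits ++ [Γ'.ket]) ++ rest))
      (veSt S (Γ'.comma :: (cbody e.lits ++ [Γ'.ket]) ++ rest) [Γ'.bit true] tmp) (1 + 2) := by
    rw [update_veSt_btw]; unfold veBody
    refine Runs.pop_cons (k := kr KR.md2) (a := Γ'.bit false) (w := []) (by simp) ?_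
    rw [update_veSt_md2]; exact Runs.push' (by simp)
  have h3 : Runs (veBody Γ'.comma) (Function.update (veSt S (Γ'.comma :: (cbody e.lits ++ [Γ'.ket]) ++ rest) [Γ'.bit true] tmp)
      (kr KR.btw) (cbody e.lits ++ [Γ'.ket] ++ rest)) (veSt S (cbody e.lits ++ [Γ'.ket] ++ rest) [Γ'.comma] tmp) (1 + 2) := by
    rw [update_veSt_btw]; unfold veBody
    refine Runs.pop_cons (k := kr KR.md2) (a := Γ'.bit true) (w := []) (by simp) ?_
    rw [update_veSt_md2]; exact Runs.push' (by simp)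
  have h4 := segRuns_ve_lits S e.lits ([Γ'.ket] ++ rest) tmp
  have h5 : Runs (veBody Γ'.ket) (Function.update (veSt S ([Γ'.ket] ++ rest) [Γ'.comma]
      ((e.lits.flatMap fun l => KCNF.encodeLiteral (l.1, false)).reverse ++ tmp)) (kr KR.btw) rest)
      (veSt S rest [] ((e.lits.flatMap fun l => KCNF.encodeLiteral (l.1, false)).reverse ++ tmp)) (0 + 2) := by
    rw [update_veSt_btw]; unfold veBody
    exact Runs.pop_cons (k := kr KR.md2) (a := Γ'.comma) (w := []) (by simp) ((Runs.skip _).of_eq (by simp) le_rfl)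
  have hk1 : veSt S (wEntry e ++ rest) [] tmp (kr KR.btw) = Γ'.bit e.pt :: (Γ'.bit e.pf :: Γ'.comma :: (cbody e.lits ++ [Γ'.ket]) ++ rest) := by
    simp [hw]
  have hk2 : veSt S (Γ'.bit e.pf :: Γ'.comma :: (cbody e.lits ++ [Γ'.ket]) ++ rest) [Γ'.bit false] tmp (kr KR.btw) =
      Γ'.bit e.pf :: (Γ'.comma :: (cbody e.lits ++ [Γ'.ket]) ++ rest) := by simp
  have hk3 : veSt S (Γ'.comma :: (cbody e.lits ++ [Γ'.ket]) ++ rest) [Γ'.bit true] tmp (kr KR.btw) =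
      Γ'.comma :: (cbody e.lits ++ [Γ'.ket] ++ rest) := by simp
  have hk5 : veSt S ([Γ'.ket] ++ rest) [Γ'.comma] ((e.lits.flatMap fun l => KCNF.encodeLiteral (l.1, false)).reverse ++ tmp)
      (kr KR.btw) = Γ'.ket :: rest := by simp
  have h45 := h4.append (SegRuns.single hk5 h5)
  have h345 := SegRuns.cons hk3 h3 (h45.cast rfl (by simp) rfl le_rfl)
  have := SegRuns.cons hk1 h1 (SegRuns.cons hk2 h2 h345)
  refine this.cast (by simp [hw]) rfl rfl ?_
  simp only [hw, List.length_cons, List.length_append]; omega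

/-- **The entries of a variable, then its `bra`.** [folklore] -/
theorem segRuns_ve_var (es : List Entry) (rest tmp : List Γ') :
    SegRuns (kr KR.btw) veBody (wVar es) (veSt S (wVar es ++ rest) [] tmp)
      (veSt S rest [] ((es.flatMap fun e => e.lits.flatMap fun l => KCNF.encodeLiteral (l.1, false)).reverse ++ tmp))
      (10 * (wVar es).length) := by
  have hmain : ∀ (es : List Entry) (rest tmp : List Γ'), SegRuns (kr KR.btw) veBody (es.flatMap wEntry)
      (veSt S (es.flatMap wEntry ++ rest) [] tmp)
      (veSt S rest [] ((es.flatMap fun e => e.lits.flatMap fun l => KCNF.encodeLiteral (l.1, false)).reverse ++ tmp))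
      (10 * (es.flatMap wEntry).length) := by
    intro es
    induction es with
    | nil => intro rest tmp; simpa using SegRuns.nil (kr KR.btw) veBody _
    | cons e es ih =>
      intro rest tmp
      have h1 := segRuns_ve_entry S e (es.flatMap wEntry ++ rest) tmp
      have h2 := ih rest ((e.lits.flatMap fun l => KCNF.encodeLiteral (l.1, false)).reverse ++ tmp)
      have := h1.append h2
      refine this.cast (by simp) (by simp) (by simp) ?_
      simp only [List.flatMap_cons, List.length_append]; omega
  have h1 := hmain es ([Γ'.bra] ++ rest) tmp
  have h2 : Runs (veBody Γ'.bra) (Function.update (veSt S ([Γ'.bra] ++ rest) []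
      ((es.flatMap fun e => e.lits.flatMap fun l => KCNF.encodeLiteral (l.1, false)).reverse ++ tmp)) (kr KR.btw) rest)
      (veSt S rest [] ((es.flatMap fun e => e.lits.flatMap fun l => KCNF.encodeLiteral (l.1, false)).reverse ++ tmp))
      (0 + 2) := by
    rw [update_veSt_btw]; unfold veBody
    exact Runs.pop_nil (by simp) ((Runs.skip _).of_eq (by simp) le_rfl)
  have hk2 : veSt S ([Γ'.bra] ++ rest) [] ((es.flatMap fun e => e.lits.flatMap fun l => KCNF.encodeLiteral (l.1, false)).reverse
      ++ tmp) (kr KR.btw) = Γ'.bra :: rest := by simp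
  have := h1.append (SegRuns.single hk2 h2)
  refine this.cast (by simp [wVar]) (by simp [wVar]) rfl ?_
  simp only [wVar, List.length_append, List.length_singleton]; omega

/-- **The variables of the wanted block.** [folklore] -/
theorem segRuns_ve_vars : ∀ (zss : List (List Entry)) (rest tmp : List Γ'),
    SegRuns (kr KR.btw) veBody (zss.flatMap wVar) (veSt S (zss.flatMap wVar ++ rest) [] tmp)
      (veSt S rest [] ((depW zss).reverse ++ tmp)) (10 * (zss.flatMap wVar).length)
  | [], rest, tmp => by simpa [depW] using SegRuns.nil (kr KR.btw) veBody _
  | es :: zss, rest, tmp => by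
    have h1 := segRuns_ve_var S es (zss.flatMap wVar ++ rest) tmp
    have h2 := segRuns_ve_vars zss rest
      ((es.flatMap fun e => e.lits.flatMap fun l => KCNF.encodeLiteral (l.1, false)).reverse ++ tmp)
    have := h1.append h2
    refine this.cast (by simp) (by simp) (by simp [depW]) ?_
    simp only [List.flatMap_cons, List.length_append]; omega

/-- **Past the block**: everything is ignored (mode `blank`). [folklore] -/
theorem segRuns_ve_ignore (tmp : List Γ') : ∀ (u rest : List Γ'),
    SegRuns (kr KR.btw) veBody u (veSt S (u ++ rest) [Γ'.blank] tmp) (veSt S rest [Γ'.blank] tmp) (5 * u.length)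
  | [], rest => by simpa using SegRuns.nil (kr KR.btw) veBody _
  | s :: u, rest => by
    have hbody : Runs (veBody s) (Function.update (veSt S (s :: u ++ rest) [Γ'.blank] tmp) (kr KR.btw) (u ++ rest))
        (veSt S (u ++ rest) [Γ'.blank] tmp) (1 + 2) := by
      rw [update_veSt_btw]; unfold veBody
      refine Runs.pop_cons (k := kr KR.md2) (a := Γ'.blank) (w := []) (by simp) ?_
      rw [update_veSt_md2]; cases s <;> exact Runs.push' (by simp)
    have ih := segRuns_ve_ignore tmp u rest
    have hk : veSt S (s :: u ++ rest) [Γ'.blank] tmp (kr KR.btw) = s :: (u ++ rest) := by simp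
    refine (SegRuns.cons hk hbody ih).cast rfl rfl rfl ?_
    simp only [List.length_cons]; omega

/-- **Skipping** (mode `bra`): non-blank symbols are passed over. [folklore] -/
theorem segRuns_ve_skip_inner (tmp : List Γ') : ∀ (u : List Γ'), Γ'.blank ∉ u → ∀ rest : List Γ',
    SegRuns (kr KR.btw) veBody u (veSt S (u ++ rest) [Γ'.bra] tmp) (veSt S rest [Γ'.bra] tmp) (5 * u.length)
  | [], _, rest => by simpa using SegRuns.nil (kr KR.btw) veBody _
  | s :: u, hu, rest => by
    have hs : s ≠ Γ'.blank := fun h => hu (by simp [h])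
    have hu' : Γ'.blank ∉ u := fun h => hu (by simp [h])
    have hbody : Runs (veBody s) (Function.update (veSt S (s :: u ++ rest) [Γ'.bra] tmp) (kr KR.btw) (u ++ rest))
        (veSt S (u ++ rest) [Γ'.bra] tmp) (1 + 2) := by
      rw [update_veSt_btw]; unfold veBody
      refine Runs.pop_cons (k := kr KR.md2) (a := Γ'.bra) (w := []) (by simp) ?_
      rw [update_veSt_md2]
      cases s with
      | blank => exact absurd rfl hs
      | bit b => exact Runs.push' (by simp)
      | bra => exact Runs.push' (by simp)
      | ket => exact Runs.push' (by simp)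
      | comma => exact Runs.push' (by simp)
    have ih := segRuns_ve_skip_inner tmp u hu' rest
    have hk : veSt S (s :: u ++ rest) [Γ'.bra] tmp (kr KR.btw) = s :: (u ++ rest) := by simp
    refine (SegRuns.cons hk hbody ih).cast rfl rfl rfl ?_
    simp only [List.length_cons]; omega

/-- **Skipping one block.** [folklore] -/
theorem segRuns_ve_skip_block (tmp : List Γ') (zss : List (List Entry)) (u rest : List Γ') :
    SegRuns (kr KR.btw) veBody (wBlock zss)
      (veSt (Function.update S (kr KR.blk) (Γ'.blank :: u)) (wBlock zss ++ rest) [Γ'.bra] tmp)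
      (veSt (Function.update S (kr KR.blk) u) rest (if u = [] then [] else [Γ'.bra]) tmp) (10 * (wBlock zss).length) := by
  have hw : wBlock zss = zss.flatMap wVar ++ [Γ'.blank] := rfl
  have h1 := segRuns_ve_skip_inner (Function.update S (kr KR.blk) (Γ'.blank :: u)) tmp (zss.flatMap wVar)
    (blank_not_mem_flatMap_wVar zss) ([Γ'.blank] ++ rest)
  have h2 : Runs (veBody Γ'.blank) (Function.update (veSt (Function.update S (kr KR.blk) (Γ'.blank :: u)) ([Γ'.blank] ++ rest)
      [Γ'.bra] tmp) (kr KR.btw) rest)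
      (veSt (Function.update S (kr KR.blk) u) rest (if u = [] then [] else [Γ'.bra]) tmp) (4 + 2 + 2) := by
    rw [update_veSt_btw]; unfold veBody
    refine Runs.pop_cons (k := kr KR.md2) (a := Γ'.bra) (w := []) (by simp) ?_
    rw [update_veSt_md2]
    refine Runs.pop_cons (k := kr KR.blk) (a := Γ'.blank) (w := u) (by simp) ?_
    rw [update_veSt_blk, Function.update_idem]
    cases u with
    | nil => rw [if_pos rfl]; exact (Runs.ifTop_nil (by simp) (Runs.skip _)).mono (by norm_num)
    | cons t u =>
      rw [if_neg (List.cons_ne_nil _ _)]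
      exact Runs.ifTop_cons (x := t) (w := u) (by simp) (Runs.push' (by simp))
  have hk2 : veSt (Function.update S (kr KR.blk) (Γ'.blank :: u)) ([Γ'.blank] ++ rest) [Γ'.bra] tmp (kr KR.btw) =
      Γ'.blank :: rest := by simp
  have := h1.append (SegRuns.single hk2 h2)
  rw [hw]
  refine this.cast rfl (by simp) rfl ?_
  simp only [List.length_append, List.length_singleton]; omega

/-- **Skipping the blocks before the wanted one.** [folklore] -/
theorem segRuns_ve_skip (tmp : List Γ') : ∀ (zsss : List (List (List Entry))) (u rest : List Γ'), zsss ≠ [] →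
    SegRuns (kr KR.btw) veBody (zsss.flatMap wBlock)
      (veSt (Function.update S (kr KR.blk) (ticks Γ'.blank zsss.length ++ u)) (zsss.flatMap wBlock ++ rest) [Γ'.bra] tmp)
      (veSt (Function.update S (kr KR.blk) u) rest (if u = [] then [] else [Γ'.bra]) tmp)
      (10 * (zsss.flatMap wBlock).length)
  | [], _, _, h => absurd rfl h
  | [zss], u, rest, _ => by
    have := segRuns_ve_skip_block S tmp zss u rest
    refine this.cast (by simp) (by simp [ticks]) rfl (by simp)
  | zss :: zss' :: zsss, u, rest, _ => by
    have h1 := segRuns_ve_skip_block S tmp zss (ticks Γ'.blank (zss' :: zsss).length ++ u) ((zss' :: zsss).flatMap wBlock ++ rest)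
    have hne : ticks Γ'.blank (zss' :: zsss).length ++ u ≠ [] := by simp [ticks]
    rw [if_neg hne] at h1
    have h2 := segRuns_ve_skip tmp (zss' :: zsss) u rest (List.cons_ne_nil _ _)
    have := h1.append h2
    refine this.cast (by simp) ?_ rfl ?_
    · simp [ticks, List.replicate_succ]
    · simp only [List.flatMap_cons, List.length_append]; omega

/-- **Specification of `vEmitBlock`**: with the block table `zsss` in `bt` and `blk = i` ticks,
the dependency literals of block `i` are pushed reversed onto `tmp`; `blk` is emptied. [folklore] -/
theorem runs_vEmitBlock (zsss : List (List (List Entry))) (i : ℕ) (hi : i < zsss.length) (tmp : List Γ')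
    (hbt : S (kr KR.bt) = wBT zsss) (hblk : S (kr KR.blk) = ticks Γ'.blank i) (ht1 : S (kr KR.t1) = [])
    (ht2 : S (kr KR.t2) = []) :
    Runs vEmitBlock (veSt S [] [] tmp) (veSt (Function.update S (kr KR.blk) []) [] [] ((depW zsss[i]).reverse ++ tmp))
      (20 * (wBT zsss).length + 11) := by
  set zs := zsss[i] with hzs
  set S' := Function.update S (kr KR.blk) [] with hS'
  have hsplit : zsss = zsss.take i ++ zs :: zsss.drop (i + 1) := by
    rw [hzs, ← List.drop_eq_getElem_cons hi, List.take_append_drop]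
  set tail := (zsss.drop (i + 1)).flatMap wBlock with htail
  have hwBT : wBT zsss = (zsss.take i).flatMap wBlock ++ (zs.flatMap wVar ++ ([Γ'.blank] ++ tail)) := by
    conv_lhs => rw [hsplit]
    simp [wBT, wBlock, htail]
  unfold vEmitBlock
  have h0 := runs_copyToG (a := kr KR.bt) (b := kr KR.btw) (t₁ := kr KR.t1) (t₂ := kr KR.t2)
    (by simp) (by simp) (by simp) (by simp) (by simp) (by simp) (veSt S [] [] tmp) (by simp [ht1]) (by simp [ht2]) (by simp)
  rw [veSt_bt, hbt, update_veSt_btw] at h0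
  have hpre : Runs ((ifTop (kr KR.blk) fun o => match o with
        | some _ => push (kr KR.md2) Γ'.bra
        | none => skip)) (veSt S (wBT zsss) [] tmp) (veSt S (wBT zsss) (if i = 0 then [] else [Γ'.bra]) tmp) 4 := by
    cases i with
    | zero => rw [if_pos rfl]; exact (Runs.ifTop_nil (by simp [hblk, ticks]) (Runs.skip _)).mono (by norm_num)
    | succ i =>
      rw [if_neg (Nat.succ_ne_zero i)]
      exact Runs.ifTop_cons (x := Γ'.blank) (w := ticks Γ'.blank i) (by simp [hblk, ticks_succ]) (Runs.push' (by simp))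
  have hskip : SegRuns (kr KR.btw) veBody ((zsss.take i).flatMap wBlock)
      (veSt S (wBT zsss) (if i = 0 then [] else [Γ'.bra]) tmp)
      (veSt S' (zs.flatMap wVar ++ ([Γ'.blank] ++ tail)) [] tmp) (10 * ((zsss.take i).flatMap wBlock).length) := by
    cases i with
    | zero =>
      rw [if_pos rfl]
      have hS0 : S' = S := by rw [hS']; exact Function.update_eq_self_iff.2 (by rw [hblk]; rfl)
      rw [hS0, hwBT]
      simp only [List.take_zero, List.flatMap_nil, List.length_nil, Nat.mul_zero, List.nil_append]
      exact SegRuns.nil (kr KR.btw) veBody _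
    | succ i =>
      rw [if_neg (Nat.succ_ne_zero i)]
      have hne : zsss.take (i + 1) ≠ [] := by
        rw [Ne, List.take_eq_nil_iff]; simp only [Nat.succ_ne_zero, false_or]; rintro rfl; simp at hi
      have hlen : (zsss.take (i + 1)).length = i + 1 := List.length_take_of_le (by omega)
      have hS1 : S = Function.update S (kr KR.blk) (ticks Γ'.blank (zsss.take (i + 1)).length ++ []) := by
        rw [hlen, List.append_nil]; exact (Function.update_eq_self_iff.2 hblk.symm).symm
      have := segRuns_ve_skip S tmp (zsss.take (i + 1)) [] (zs.flatMap wVar ++ ([Γ'.blank] ++ tail)) hne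
      rw [if_pos rfl, ← hS1, ← hS'] at this
      refine this.cast rfl (by rw [hwBT]) rfl le_rfl
  have hvars := segRuns_ve_vars S' zs ([Γ'.blank] ++ tail) tmp
  have hblank : Runs (veBody Γ'.blank) (Function.update (veSt S' ([Γ'.blank] ++ tail) [] ((depW zs).reverse ++ tmp))
      (kr KR.btw) tail) (veSt S' tail [Γ'.blank] ((depW zs).reverse ++ tmp)) (1 + 2) := by
    rw [update_veSt_btw]; unfold veBody
    exact Runs.pop_nil (by simp) (Runs.push' (by simp))
  have hkb : veSt S' ([Γ'.blank] ++ tail) [] ((depW zs).reverse ++ tmp) (kr KR.btw) = Γ'.blank :: tail := by simp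
  have hign := segRuns_ve_ignore S' ((depW zs).reverse ++ tmp) tail []
  rw [List.append_nil] at hign
  have hloop := ((hskip.append (hvars.append ((SegRuns.single hkb hblank).append hign))).runs_loop_nil (by simp))
  have hclear := runs_clear (kr KR.md2) (veSt S' [] [Γ'.blank] ((depW zs).reverse ++ tmp))
  rw [veSt_md2, update_veSt_md2] at hclear
  refine (h0.seq (hpre.seq (hloop.seq hclear))).cast rfl rfl ?_
  rw [hwBT]
  simp only [List.length_append, List.length_cons, List.length_nil]
  omega

end VeSpec

/-! ### Writing the renaming variables of a block into the tuple register -/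

/-- Body of the pass writing the index tokens of block `iu2` of the `Y`-table (copy in `ytw`) onto
`tmp` as literals of polarity `false`: modes `bra` (skip), nothing (the `f`-blanks), `comma`
(token start), `ket` (inside a token), `blank` (done). [folklore] -/
def yeBody (s : Γ') : RProg :=
  pop (kr KR.md2) fun o => match o, s with
    | some Γ'.bra, Γ'.ket => pop (kr KR.iu2) fun _ => ifTop (kr KR.iu2) fun o' => match o' with
        | some _ => push (kr KR.md2) Γ'.bra
        | none => skip
    | some Γ'.bra, _ => push (kr KR.md2) Γ'.bra
    | none, Γ'.blank => skip
    | none, Γ'.comma => push (kr KR.md2) Γ'.comma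
    | some Γ'.comma, Γ'.bit d => emit (Γ'.bit false) ;; emit (Γ'.bit d) ;; push (kr KR.md2) Γ'.ket
    | some Γ'.comma, Γ'.comma => emit (Γ'.bit false) ;; emit Γ'.comma ;; push (kr KR.md2) Γ'.comma
    | some Γ'.comma, Γ'.ket => push (kr KR.md2) Γ'.blank
    | some Γ'.ket, Γ'.bit d => emit (Γ'.bit d) ;; push (kr KR.md2) Γ'.ket
    | some Γ'.ket, Γ'.comma => emit Γ'.comma ;; push (kr KR.md2) Γ'.comma
    | some Γ'.blank, _ => push (kr KR.md2) Γ'.blank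
    | _, _ => skip

/-- `yEmit`: push onto `tmp` (reversed) the literals `(y, false)` for the renaming variables `y`
of block `iu2` (ticks; emptied), read off a fresh copy of the `Y`-table. [folklore] -/
def yEmit : RProg :=
  copyToG (kr KR.yt) (kr KR.ytw) (kr KR.t1) (kr KR.t2) ;;
  (ifTop (kr KR.iu2) fun o => match o with
    | some _ => push (kr KR.md2) Γ'.bra
    | none => skip) ;;
  loop (kr KR.ytw) yeBody ;; clear (kr KR.md2)

/-- The word of the renaming literals of a list of new indices. [folklore] -/
def yLitW (ys : List ℕ) : List Γ' := ys.flatMap fun y => KCNF.encodeLiteral (y, false)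

/-- The store during `yEmit`: the copy `ytw`, the mode `md2`, the staging register `tmp`.
[folklore] -/
def yeSt (S : RStore) (ytw md2 tmp : List Γ') : RStore := fun r =>
  if r = kr KR.ytw then ytw else if r = kr KR.md2 then md2 else if r = tb TB.tmp then tmp else S r

section YeSt

variable (S : RStore) (ytw md2 tmp w : List Γ')

/-- Reading `ytw`. [folklore] -/
@[simp] theorem yeSt_ytw : yeSt S ytw md2 tmp (kr KR.ytw) = ytw := by simp [yeSt]
/-- Reading `md2`. [folklore] -/
@[simp] theorem yeSt_md2 : yeSt S ytw md2 tmp (kr KR.md2) = md2 := by simp [yeSt]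
/-- Reading `tmp`. [folklore] -/
@[simp] theorem yeSt_tmp : yeSt S ytw md2 tmp (tb TB.tmp) = tmp := by simp [yeSt]
/-- Reading any other register. [folklore] -/
theorem yeSt_other {r : Reg} (h0 : r ≠ kr KR.ytw) (h1 : r ≠ kr KR.md2) (h2 : r ≠ tb TB.tmp) :
    yeSt S ytw md2 tmp r = S r := by simp [yeSt, h0, h1, h2]
/-- Reading `iu2`. [folklore] -/
@[simp] theorem yeSt_iu2 : yeSt S ytw md2 tmp (kr KR.iu2) = S (kr KR.iu2) := by simp [yeSt]
/-- Reading `yt`. [folklore] -/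
@[simp] theorem yeSt_yt : yeSt S ytw md2 tmp (kr KR.yt) = S (kr KR.yt) := by simp [yeSt]
/-- Reading `t1`. [folklore] -/
@[simp] theorem yeSt_t1 : yeSt S ytw md2 tmp (kr KR.t1) = S (kr KR.t1) := by simp [yeSt]
/-- Reading `t2`. [folklore] -/
@[simp] theorem yeSt_t2 : yeSt S ytw md2 tmp (kr KR.t2) = S (kr KR.t2) := by simp [yeSt]
/-- Updating `ytw`. [folklore] -/
@[simp] theorem update_yeSt_ytw : Function.update (yeSt S ytw md2 tmp) (kr KR.ytw) w = yeSt S w md2 tmp := by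
  funext r; by_cases h : r = kr KR.ytw
  · subst h; simp
  · rw [Function.update_of_ne h]; simp [yeSt, h]
/-- Updating `md2`. [folklore] -/
@[simp] theorem update_yeSt_md2 : Function.update (yeSt S ytw md2 tmp) (kr KR.md2) w = yeSt S ytw w tmp := by
  funext r; by_cases h : r = kr KR.md2
  · subst h; simp
  · rw [Function.update_of_ne h]; simp [yeSt, h]
/-- Updating `tmp`. [folklore] -/
@[simp] theorem update_yeSt_tmp : Function.update (yeSt S ytw md2 tmp) (tb TB.tmp) w = yeSt S ytw md2 w := by
  funext r; by_cases h : r = tb TB.tmp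
  · subst h; simp
  · rw [Function.update_of_ne h]; simp [yeSt, h]
/-- Updating `iu2` commutes with the family. [folklore] -/
theorem update_yeSt_iu2 (u : List Γ') :
    Function.update (yeSt S ytw md2 tmp) (kr KR.iu2) u = yeSt (Function.update S (kr KR.iu2) u) ytw md2 tmp := by
  funext r; by_cases h : r = kr KR.iu2
  · subst h; simp [yeSt]
  · rw [Function.update_of_ne h]; simp only [yeSt, Function.update_of_ne h]

end YeSt

section YeSpec

variable (S : RStore)

/-- **Skipping** (mode `bra`). [folklore] -/
theorem segRuns_ye_skip_inner (tmp : List Γ') : ∀ (u : List Γ'), Γ'.ket ∉ u → ∀ rest : List Γ',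
    SegRuns (kr KR.ytw) yeBody u (yeSt S (u ++ rest) [Γ'.bra] tmp) (yeSt S rest [Γ'.bra] tmp) (5 * u.length)
  | [], _, rest => by simpa using SegRuns.nil (kr KR.ytw) yeBody _
  | s :: u, hu, rest => by
    have hs : s ≠ Γ'.ket := fun h => hu (by simp [h])
    have hu' : Γ'.ket ∉ u := fun h => hu (by simp [h])
    have hbody : Runs (yeBody s) (Function.update (yeSt S (s :: u ++ rest) [Γ'.bra] tmp) (kr KR.ytw) (u ++ rest))
        (yeSt S (u ++ rest) [Γ'.bra] tmp) (1 + 2) := by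
      rw [update_yeSt_ytw]; unfold yeBody
      refine Runs.pop_cons (k := kr KR.md2) (a := Γ'.bra) (w := []) (by simp) ?_
      rw [update_yeSt_md2]
      cases s with
      | ket => exact absurd rfl hs
      | bit b => exact Runs.push' (by simp)
      | bra => exact Runs.push' (by simp)
      | blank => exact Runs.push' (by simp)
      | comma => exact Runs.push' (by simp)
    have ih := segRuns_ye_skip_inner tmp u hu' rest
    have hk : yeSt S (s :: u ++ rest) [Γ'.bra] tmp (kr KR.ytw) = s :: (u ++ rest) := by simp
    refine (SegRuns.cons hk hbody ih).cast rfl rfl rfl ?_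
    simp only [List.length_cons]; omega

/-- **Skipping one `Y`-block.** [folklore] -/
theorem segRuns_ye_skip_block (tmp : List Γ') (f : ℕ) (ys : List ℕ) (u rest : List Γ') :
    SegRuns (kr KR.ytw) yeBody (wYBlock f ys) (yeSt (Function.update S (kr KR.iu2) (Γ'.blank :: u)) (wYBlock f ys ++ rest) [Γ'.bra] tmp)
      (yeSt (Function.update S (kr KR.iu2) u) rest (if u = [] then [] else [Γ'.bra]) tmp) (10 * (wYBlock f ys).length) := by
  rw [wYBlock_eq]
  set pre := List.replicate f Γ'.blank ++ Γ'.comma :: ys.flatMap wIdx with hpre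
  have h1 := segRuns_ye_skip_inner (Function.update S (kr KR.iu2) (Γ'.blank :: u)) tmp pre
    (by rw [hpre]; exact ket_not_mem_yBlock_prefix f ys) ([Γ'.ket] ++ rest)
  have h2 : Runs (yeBody Γ'.ket) (Function.update (yeSt (Function.update S (kr KR.iu2) (Γ'.blank :: u)) ([Γ'.ket] ++ rest)
      [Γ'.bra] tmp) (kr KR.ytw) rest)
      (yeSt (Function.update S (kr KR.iu2) u) rest (if u = [] then [] else [Γ'.bra]) tmp) (4 + 2 + 2) := by
    rw [update_yeSt_ytw]; unfold yeBody
    refine Runs.pop_cons (k := kr KR.md2) (a := Γ'.bra) (w := []) (by simp) ?_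
    rw [update_yeSt_md2]
    refine Runs.pop_cons (k := kr KR.iu2) (a := Γ'.blank) (w := u) (by simp) ?_
    rw [update_yeSt_iu2, Function.update_idem]
    cases u with
    | nil => rw [if_pos rfl]; exact (Runs.ifTop_nil (by simp) (Runs.skip _)).mono (by norm_num)
    | cons t u =>
      rw [if_neg (List.cons_ne_nil _ _)]
      exact Runs.ifTop_cons (x := t) (w := u) (by simp) (Runs.push' (by simp))
  have hk2 : yeSt (Function.update S (kr KR.iu2) (Γ'.blank :: u)) ([Γ'.ket] ++ rest) [Γ'.bra] tmp (kr KR.ytw) =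
      Γ'.ket :: rest := by simp
  have := h1.append (SegRuns.single hk2 h2)
  refine this.cast rfl (by simp) rfl ?_
  simp only [List.length_append, List.length_singleton]; omega

/-- **Skipping the `Y`-blocks before the wanted one.** [folklore] -/
theorem segRuns_ye_skip (tmp : List Γ') : ∀ (t : List (ℕ × List ℕ)) (u rest : List Γ'), t ≠ [] →
    SegRuns (kr KR.ytw) yeBody (t.flatMap fun b => wYBlock b.1 b.2)
      (yeSt (Function.update S (kr KR.iu2) (ticks Γ'.blank t.length ++ u)) ((t.flatMap fun b => wYBlock b.1 b.2) ++ rest)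
        [Γ'.bra] tmp)
      (yeSt (Function.update S (kr KR.iu2) u) rest (if u = [] then [] else [Γ'.bra]) tmp)
      (10 * (t.flatMap fun b => wYBlock b.1 b.2).length)
  | [], _, _, h => absurd rfl h
  | [b], u, rest, _ => by
    have := segRuns_ye_skip_block S tmp b.1 b.2 u rest
    refine this.cast (by simp) (by simp [ticks]) rfl (by simp)
  | b :: b' :: t, u, rest, _ => by
    have h1 := segRuns_ye_skip_block S tmp b.1 b.2 (ticks Γ'.blank (b' :: t).length ++ u)
      (((b' :: t).flatMap fun b => wYBlock b.1 b.2) ++ rest)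
    have hne : ticks Γ'.blank (b' :: t).length ++ u ≠ [] := by simp [ticks]
    rw [if_neg hne] at h1
    have h2 := segRuns_ye_skip tmp (b' :: t) u rest (List.cons_ne_nil _ _)
    have := h1.append h2
    refine this.cast (by simp) ?_ rfl ?_
    · simp [ticks, List.replicate_succ]
    · simp only [List.flatMap_cons, List.length_append]; omega

/-- **The `f`-blanks are passed**; the comma opens the tokens. [folklore] -/
theorem segRuns_ye_blanks (f : ℕ) (rest tmp : List Γ') :
    SegRuns (kr KR.ytw) yeBody (List.replicate f Γ'.blank ++ [Γ'.comma])
      (yeSt S (List.replicate f Γ'.blank ++ [Γ'.comma] ++ rest) [] tmp) (yeSt S rest [Γ'.comma] tmp) (5 * (f + 1)) := by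
  have h1 : ∀ rest' : List Γ', SegRuns (kr KR.ytw) yeBody (List.replicate f Γ'.blank)
      (yeSt S (List.replicate f Γ'.blank ++ rest') [] tmp) (yeSt S rest' [] tmp) (4 * f) := by
    induction f with
    | zero => intro rest'; simpa using SegRuns.nil (kr KR.ytw) yeBody _
    | succ f ih =>
      intro rest'
      have hbody : Runs (yeBody Γ'.blank) (Function.update (yeSt S (Γ'.blank :: (List.replicate f Γ'.blank ++ rest')) [] tmp)
          (kr KR.ytw) (List.replicate f Γ'.blank ++ rest')) (yeSt S (List.replicate f Γ'.blank ++ rest') [] tmp) (0 + 2) := by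
        rw [update_yeSt_ytw]; unfold yeBody
        exact Runs.pop_nil (by simp) (Runs.skip _)
      have hk : yeSt S (Γ'.blank :: (List.replicate f Γ'.blank ++ rest')) [] tmp (kr KR.ytw) =
          Γ'.blank :: (List.replicate f Γ'.blank ++ rest') := by simp
      refine (SegRuns.cons hk hbody (ih rest')).cast (by simp [List.replicate_succ]) (by simp [List.replicate_succ]) rfl (by omega)
  have h2 : Runs (yeBody Γ'.comma) (Function.update (yeSt S ([Γ'.comma] ++ rest) [] tmp) (kr KR.ytw) rest)
      (yeSt S rest [Γ'.comma] tmp) (1 + 2) := by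
    rw [update_yeSt_ytw]; unfold yeBody
    exact Runs.pop_nil (by simp) (Runs.push' (by simp))
  have hk2 : yeSt S ([Γ'.comma] ++ rest) [] tmp (kr KR.ytw) = Γ'.comma :: rest := by simp
  have := (h1 ([Γ'.comma] ++ rest)).append (SegRuns.single hk2 h2)
  refine this.cast rfl (by simp) rfl ?_
  omega

/-- Inside a token (mode `ket`): index bits are emitted. [folklore] -/
theorem segRuns_ye_bits : ∀ (u : List Bool) (rest tmp : List Γ'),
    SegRuns (kr KR.ytw) yeBody (u.map Γ'.bit) (yeSt S (u.map Γ'.bit ++ rest) [Γ'.ket] tmp)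
      (yeSt S rest [Γ'.ket] ((u.map Γ'.bit).reverse ++ tmp)) (6 * u.length)
  | [], rest, tmp => by simpa using SegRuns.nil (kr KR.ytw) yeBody _
  | d :: u, rest, tmp => by
    have hbody : Runs (yeBody (Γ'.bit d)) (Function.update (yeSt S (Γ'.bit d :: (u.map Γ'.bit ++ rest)) [Γ'.ket] tmp)
        (kr KR.ytw) (u.map Γ'.bit ++ rest)) (yeSt S (u.map Γ'.bit ++ rest) [Γ'.ket] (Γ'.bit d :: tmp)) (2 + 2) := by
      rw [update_yeSt_ytw]; unfold yeBody
      refine Runs.pop_cons (k := kr KR.md2) (a := Γ'.ket) (w := []) (by simp) ?_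
      rw [update_yeSt_md2]
      exact ((Runs.push' (R' := yeSt S (u.map Γ'.bit ++ rest) [] (Γ'.bit d :: tmp)) (by simp)).seq
        (Runs.push' (by simp))).of_eq rfl (by norm_num)
    have ih := segRuns_ye_bits u rest (Γ'.bit d :: tmp)
    have hk : yeSt S (Γ'.bit d :: (u.map Γ'.bit ++ rest)) [Γ'.ket] tmp (kr KR.ytw) = Γ'.bit d :: (u.map Γ'.bit ++ rest) := by
      simp
    refine (SegRuns.cons hk hbody ih).cast (by simp) (by simp) (by simp) ?_
    simp only [List.length_cons]; omega

/-- **One index token** is emitted as the literal `(y, false)` (mode `comma` before and after).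
[folklore] -/
theorem segRuns_ye_token (y : ℕ) (rest tmp : List Γ') :
    SegRuns (kr KR.ytw) yeBody (wIdx y) (yeSt S (wIdx y ++ rest) [Γ'.comma] tmp)
      (yeSt S rest [Γ'.comma] ((KCNF.encodeLiteral (y, false)).reverse ++ tmp)) (10 * (wIdx y).length + 2) := by
  have hlit : KCNF.encodeLiteral (y, false) = Γ'.bit false :: ((encodeNat y).map Γ'.bit ++ [Γ'.comma]) := rfl
  rw [hlit, wIdx_eq]
  cases hb : encodeNat y with
  | nil =>
    -- the empty token
    simp only [List.map_nil, List.nil_append]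
    have h : Runs (yeBody Γ'.comma) (Function.update (yeSt S ([Γ'.comma] ++ rest) [Γ'.comma] tmp) (kr KR.ytw) rest)
        (yeSt S rest [Γ'.comma] (Γ'.comma :: Γ'.bit false :: tmp)) (3 + 2) := by
      rw [update_yeSt_ytw]; unfold yeBody
      refine Runs.pop_cons (k := kr KR.md2) (a := Γ'.comma) (w := []) (by simp) ?_
      rw [update_yeSt_md2]
      exact ((Runs.push' (R' := yeSt S rest [] (Γ'.bit false :: tmp)) (by simp)).seq
        ((Runs.push' (R' := yeSt S rest [] (Γ'.comma :: Γ'.bit false :: tmp)) (by simp)).seq (Runs.push' (by simp)))).of_eq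
        rfl (by norm_num)
    have hk : yeSt S ([Γ'.comma] ++ rest) [Γ'.comma] tmp (kr KR.ytw) = Γ'.comma :: rest := by simp
    exact (SegRuns.single hk h).cast rfl rfl (by simp) (by simp)
  | cons d ds =>
    simp only [List.map_cons, List.cons_append]
    set u := ds.map Γ'.bit with hu
    have h1 : Runs (yeBody (Γ'.bit d)) (Function.update (yeSt S (Γ'.bit d :: (u ++ [Γ'.comma] ++ rest)) [Γ'.comma] tmp)
        (kr KR.ytw) (u ++ [Γ'.comma] ++ rest)) (yeSt S (u ++ [Γ'.comma] ++ rest) [Γ'.ket] (Γ'.bit d :: Γ'.bit false :: tmp))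
        (3 + 2) := by
      rw [update_yeSt_ytw]; unfold yeBody
      refine Runs.pop_cons (k := kr KR.md2) (a := Γ'.comma) (w := []) (by simp) ?_
      rw [update_yeSt_md2]
      exact ((Runs.push' (R' := yeSt S (u ++ [Γ'.comma] ++ rest) [] (Γ'.bit false :: tmp)) (by simp)).seq
        ((Runs.push' (R' := yeSt S (u ++ [Γ'.comma] ++ rest) [] (Γ'.bit d :: Γ'.bit false :: tmp)) (by simp)).seq
        (Runs.push' (by simp)))).of_eq rfl (by norm_num)
    have h2 := segRuns_ye_bits S ds ([Γ'.comma] ++ rest) (Γ'.bit d :: Γ'.bit false :: tmp)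
    rw [← hu] at h2
    have h3 : Runs (yeBody Γ'.comma) (Function.update (yeSt S ([Γ'.comma] ++ rest) [Γ'.ket] (u.reverse ++ Γ'.bit d :: Γ'.bit false :: tmp))
        (kr KR.ytw) rest) (yeSt S rest [Γ'.comma] (Γ'.comma :: (u.reverse ++ Γ'.bit d :: Γ'.bit false :: tmp))) (2 + 2) := by
      rw [update_yeSt_ytw]; unfold yeBody
      refine Runs.pop_cons (k := kr KR.md2) (a := Γ'.ket) (w := []) (by simp) ?_
      rw [update_yeSt_md2]
      exact ((Runs.push' (R' := yeSt S rest [] (Γ'.comma :: (u.reverse ++ Γ'.bit d :: Γ'.bit false :: tmp))) (by simp)).seq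
        (Runs.push' (by simp))).of_eq rfl (by norm_num)
    have hk1 : yeSt S (Γ'.bit d :: (u ++ [Γ'.comma] ++ rest)) [Γ'.comma] tmp (kr KR.ytw) = Γ'.bit d :: (u ++ [Γ'.comma] ++ rest) := by
      simp
    have hk3 : yeSt S ([Γ'.comma] ++ rest) [Γ'.ket] (u.reverse ++ Γ'.bit d :: Γ'.bit false :: tmp) (kr KR.ytw) = Γ'.comma :: rest := by
      simp
    have h23 := h2.append (SegRuns.single hk3 h3)
    have := SegRuns.cons hk1 h1 (h23.cast rfl (by simp) rfl le_rfl)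
    refine this.cast (by simp) (by simp) (by simp) ?_
    have : u.length = ds.length := by simp [hu]
    simp only [List.length_cons, List.length_append, List.length_nil]; omega

/-- **The tokens of the wanted block.** [folklore] -/
theorem segRuns_ye_tokens : ∀ (ys : List ℕ) (rest tmp : List Γ'),
    SegRuns (kr KR.ytw) yeBody (ys.flatMap wIdx) (yeSt S (ys.flatMap wIdx ++ rest) [Γ'.comma] tmp)
      (yeSt S rest [Γ'.comma] ((yLitW ys).reverse ++ tmp)) (12 * (ys.flatMap wIdx).length)
  | [], rest, tmp => by simpa [yLitW] using SegRuns.nil (kr KR.ytw) yeBody _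
  | y :: ys, rest, tmp => by
    have h1 := segRuns_ye_token S y (ys.flatMap wIdx ++ rest) tmp
    have h2 := segRuns_ye_tokens ys rest ((KCNF.encodeLiteral (y, false)).reverse ++ tmp)
    have := h1.append h2
    refine this.cast (by simp) (by simp) (by simp [yLitW]) ?_
    have : 1 ≤ (wIdx y).length := by simp [wIdx]
    simp only [List.flatMap_cons, List.length_append]; omega

/-- **Done**: everything is ignored (mode `blank`). [folklore] -/
theorem segRuns_ye_ignore (tmp : List Γ') : ∀ (u rest : List Γ'),
    SegRuns (kr KR.ytw) yeBody u (yeSt S (u ++ rest) [Γ'.blank] tmp) (yeSt S rest [Γ'.blank] tmp) (5 * u.length)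
  | [], rest => by simpa using SegRuns.nil (kr KR.ytw) yeBody _
  | s :: u, rest => by
    have hbody : Runs (yeBody s) (Function.update (yeSt S (s :: u ++ rest) [Γ'.blank] tmp) (kr KR.ytw) (u ++ rest))
        (yeSt S (u ++ rest) [Γ'.blank] tmp) (1 + 2) := by
      rw [update_yeSt_ytw]; unfold yeBody
      refine Runs.pop_cons (k := kr KR.md2) (a := Γ'.blank) (w := []) (by simp) ?_
      rw [update_yeSt_md2]; cases s <;> exact Runs.push' (by simp)
    have ih := segRuns_ye_ignore tmp u rest
    have hk : yeSt S (s :: u ++ rest) [Γ'.blank] tmp (kr KR.ytw) = s :: (u ++ rest) := by simp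
    refine (SegRuns.cons hk hbody ih).cast rfl rfl rfl ?_
    simp only [List.length_cons]; omega

/-- **Specification of `yEmit`**: with the `Y`-table `t` in `yt` and `iu2 = i` ticks, the renaming
literals of block `i` are pushed reversed onto `tmp`; `iu2` is emptied. [folklore] -/
theorem runs_yEmit (t : List (ℕ × List ℕ)) (i : ℕ) (hi : i < t.length) (tmp : List Γ') (hyt : S (kr KR.yt) = wYT t)
    (hiu2 : S (kr KR.iu2) = ticks Γ'.blank i) (ht1 : S (kr KR.t1) = []) (ht2 : S (kr KR.t2) = []) :
    Runs yEmit (yeSt S [] [] tmp) (yeSt (Function.update S (kr KR.iu2) []) [] [] ((yLitW (t[i]).2).reverse ++ tmp))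
      (22 * (wYT t).length + 11) := by
  set f := (t[i]).1 with hf
  set ys := (t[i]).2 with hys0
  set S' := Function.update S (kr KR.iu2) [] with hS'
  have ht : t[i] = (f, ys) := by rw [hf, hys0]
  have hsplit : t = t.take i ++ (f, ys) :: t.drop (i + 1) := by
    rw [← ht, ← List.drop_eq_getElem_cons hi, List.take_append_drop]
  set B : ℕ × List ℕ → List Γ' := fun b => wYBlock b.1 b.2 with hBdef
  set tail := (t.drop (i + 1)).flatMap B with htail
  have hwYT : wYT t = (t.take i).flatMap B ++ (wYBlock f ys ++ tail) := by
    conv_lhs => rw [hsplit]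
    simp [wYT, hBdef, htail]
  unfold yEmit
  have h0 := runs_copyToG (a := kr KR.yt) (b := kr KR.ytw) (t₁ := kr KR.t1) (t₂ := kr KR.t2)
    (by simp) (by simp) (by simp) (by simp) (by simp) (by simp) (yeSt S [] [] tmp) (by simp [ht1]) (by simp [ht2]) (by simp)
  rw [yeSt_yt, hyt, update_yeSt_ytw] at h0
  have hpre : Runs ((ifTop (kr KR.iu2) fun o => match o with
        | some _ => push (kr KR.md2) Γ'.bra
        | none => skip)) (yeSt S (wYT t) [] tmp) (yeSt S (wYT t) (if i = 0 then [] else [Γ'.bra]) tmp) 4 := by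
    cases i with
    | zero => rw [if_pos rfl]; exact (Runs.ifTop_nil (by simp [hiu2, ticks]) (Runs.skip _)).mono (by norm_num)
    | succ i =>
      rw [if_neg (Nat.succ_ne_zero i)]
      exact Runs.ifTop_cons (x := Γ'.blank) (w := ticks Γ'.blank i) (by simp [hiu2, ticks_succ]) (Runs.push' (by simp))
  have hN5 : wYBlock f ys ++ tail = List.replicate f Γ'.blank ++ [Γ'.comma] ++ (ys.flatMap wIdx ++ (Γ'.ket :: tail)) := by
    rw [wYBlock_eq]; simp
  have hskip : SegRuns (kr KR.ytw) yeBody ((t.take i).flatMap B) (yeSt S (wYT t) (if i = 0 then [] else [Γ'.bra]) tmp)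
      (yeSt S' (List.replicate f Γ'.blank ++ [Γ'.comma] ++ (ys.flatMap wIdx ++ (Γ'.ket :: tail))) [] tmp)
      (10 * ((t.take i).flatMap B).length) := by
    rw [← hN5]
    cases i with
    | zero =>
      rw [if_pos rfl]
      have hS0 : S' = S := by rw [hS']; exact Function.update_eq_self_iff.2 (by rw [hiu2]; rfl)
      rw [hS0, hwYT]
      simp only [List.take_zero, List.flatMap_nil, List.nil_append, List.length_nil, Nat.mul_zero]
      exact SegRuns.nil (kr KR.ytw) yeBody _
    | succ i =>
      rw [if_neg (Nat.succ_ne_zero i)]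
      have hne : t.take (i + 1) ≠ [] := by
        rw [Ne, List.take_eq_nil_iff]; simp only [Nat.succ_ne_zero, false_or]; rintro rfl; simp at hi
      have hlen : (t.take (i + 1)).length = i + 1 := List.length_take_of_le (by omega)
      have hS1 : S = Function.update S (kr KR.iu2) (ticks Γ'.blank (t.take (i + 1)).length ++ []) := by
        rw [hlen, List.append_nil]; exact (Function.update_eq_self_iff.2 hiu2.symm).symm
      have := segRuns_ye_skip S tmp (t.take (i + 1)) [] (wYBlock f ys ++ tail) hne
      rw [if_pos rfl, ← hS1, ← hS'] at this
      refine this.cast rfl (by rw [hwYT]) rfl le_rfl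
  have hblanks := segRuns_ye_blanks S' f (ys.flatMap wIdx ++ (Γ'.ket :: tail)) tmp
  have htok := segRuns_ye_tokens S' ys (Γ'.ket :: tail) tmp
  have hket : Runs (yeBody Γ'.ket) (Function.update (yeSt S' (Γ'.ket :: tail) [Γ'.comma] ((yLitW ys).reverse ++ tmp)) (kr KR.ytw) tail)
      (yeSt S' tail [Γ'.blank] ((yLitW ys).reverse ++ tmp)) (1 + 2) := by
    rw [update_yeSt_ytw]; unfold yeBody
    refine Runs.pop_cons (k := kr KR.md2) (a := Γ'.comma) (w := []) (by simp) ?_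
    rw [update_yeSt_md2]; exact Runs.push' (by simp)
  have hkk : yeSt S' (Γ'.ket :: tail) [Γ'.comma] ((yLitW ys).reverse ++ tmp) (kr KR.ytw) = Γ'.ket :: tail := by simp
  have hig := segRuns_ye_ignore S' ((yLitW ys).reverse ++ tmp) tail []
  rw [List.append_nil] at hig
  have hloop := (hskip.append (hblanks.append (htok.append ((SegRuns.single hkk hket).append hig)))).runs_loop_nil (by simp)
  have hc := runs_clear (kr KR.md2) (yeSt S' [] [Γ'.blank] ((yLitW ys).reverse ++ tmp))
  rw [yeSt_md2, update_yeSt_md2] at hc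
  refine (h0.seq (hpre.seq (hloop.seq hc))).cast rfl rfl ?_
  have hlenW : (wYT t).length = ((t.take i).flatMap B).length + (f + 1) + (ys.flatMap wIdx).length + 1 + tail.length := by
    rw [hwYT, wYBlock_eq]
    simp only [List.length_append, List.length_replicate, List.length_cons, List.length_nil]
    omega
  rw [hlenW]
  simp only [List.length_cons, List.length_nil]
  omega

end YeSpec

/-! ### Building the dependency list of a clause in the tuple register -/

/-- **`vEmitBlock` on any store** (hypothesis form). [folklore] -/
theorem runs_vEmitBlock' (R : RStore) (zsss : List (List (List Entry))) (i : ℕ) (hi : i < zsss.length)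
    (hbt : R (kr KR.bt) = wBT zsss) (hblk : R (kr KR.blk) = ticks Γ'.blank i) (ht1 : R (kr KR.t1) = [])
    (ht2 : R (kr KR.t2) = []) (hbtw : R (kr KR.btw) = []) (hmd2 : R (kr KR.md2) = []) :
    Runs vEmitBlock R (Function.update (Function.update R (kr KR.blk) []) (tb TB.tmp) ((depW zsss[i]).reverse ++ R (tb TB.tmp)))
      (20 * (wBT zsss).length + 11) := by
  have e := veSt_eta R
  rw [hbtw, hmd2] at e
  have h := runs_vEmitBlock R zsss i hi (R (tb TB.tmp)) hbt hblk ht1 ht2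
  rw [e] at h
  refine h.of_eq ?_ le_rfl
  funext q
  by_cases h1 : q = tb TB.tmp; · subst h1; simp
  by_cases h2 : q = kr KR.blk; · subst h2; simp [veSt]
  rw [Function.update_of_ne h1, Function.update_of_ne h2]
  by_cases g1 : q = kr KR.btw; · subst g1; simp [hbtw]
  by_cases g2 : q = kr KR.md2; · subst g2; simp [hmd2]
  rw [veSt_other _ _ _ _ g1 g2 h1, Function.update_of_ne h2]

/-- **`yEmit` on any store** (hypothesis form). [folklore] -/
theorem runs_yEmit' (R : RStore) (t : List (ℕ × List ℕ)) (i : ℕ) (hi : i < t.length) (hyt : R (kr KR.yt) = wYT t)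
    (hiu2 : R (kr KR.iu2) = ticks Γ'.blank i) (ht1 : R (kr KR.t1) = []) (ht2 : R (kr KR.t2) = []) (hytw : R (kr KR.ytw) = [])
    (hmd2 : R (kr KR.md2) = []) :
    Runs yEmit R (Function.update (Function.update R (kr KR.iu2) []) (tb TB.tmp) ((yLitW (t[i]).2).reverse ++ R (tb TB.tmp)))
      (22 * (wYT t).length + 11) := by
  have e : yeSt R (R (kr KR.ytw)) (R (kr KR.md2)) (R (tb TB.tmp)) = R := by
    funext r
    by_cases h0 : r = kr KR.ytw; · subst h0; simp
    by_cases h1 : r = kr KR.md2; · subst h1; simp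
    by_cases h2 : r = tb TB.tmp; · subst h2; simp
    rw [yeSt_other _ _ _ _ h0 h1 h2]
  rw [hytw, hmd2] at e
  have h := runs_yEmit R t i hi (R (tb TB.tmp)) hyt hiu2 ht1 ht2
  rw [e] at h
  refine h.of_eq ?_ le_rfl
  funext q
  by_cases h1 : q = tb TB.tmp; · subst h1; simp
  by_cases h2 : q = kr KR.iu2; · subst h2; simp [yeSt]
  rw [Function.update_of_ne h1, Function.update_of_ne h2]
  by_cases g1 : q = kr KR.ytw; · subst g1; simp [hytw]
  by_cases g2 : q = kr KR.md2; · subst g2; simp [hmd2]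
  rw [yeSt_other _ _ _ _ g1 g2 h1, Function.update_of_ne h2]

/-- Body of the scan of the annotated clause (copy in `clw`) building its dependency list on
`tmp`: modes in `md` — nothing (polarity bit, dropped), `blank` (tag bit), `comma` (payload of an
`A`-literal: emitted as the literal `(ν, false)`), `ket` (payload of a `B`-literal: kets to
`blk`/`iu2`, bras dropped, at the comma the block's dependency literals and renaming literals are
emitted). [folklore] -/
def vbBody (s : Γ') : RProg :=
  pop (kr KR.md) fun o => match o, s with
    | none, Γ'.bit _ => push (kr KR.md) Γ'.blank
    | some Γ'.blank, Γ'.bit false => emit (Γ'.bit false) ;; push (kr KR.md) Γ'.comma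
    | some Γ'.blank, Γ'.bit true => push (kr KR.md) Γ'.ket
    | some Γ'.comma, Γ'.bit d => emit (Γ'.bit d) ;; push (kr KR.md) Γ'.comma
    | some Γ'.comma, Γ'.comma => emit Γ'.comma
    | some Γ'.ket, Γ'.ket => push (kr KR.blk) Γ'.blank ;; push (kr KR.iu2) Γ'.blank ;; push (kr KR.md) Γ'.ket
    | some Γ'.ket, Γ'.bra => push (kr KR.md) Γ'.ket
    | some Γ'.ket, Γ'.comma => vEmitBlock ;; yEmit
    | _, _ => skip

/-- **`vBuild`**: with the annotated clause in `cl` (kept), write the literal list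
`cbody ((depClause P F c).map (·, false))` — the dependency variables with the all-false tuple —
into the tuple register `vt`. [folklore] -/
def vBuild : RProg :=
  copyToG (kr KR.cl) (kr KR.clw) (kr KR.t1) (kr KR.t2) ;; loop (kr KR.clw) vbBody ;; pour (tb TB.tmp) (tb TB.vt)

/-- The dependency word of an annotated literal, from the tables. [folklore] -/
def alDepW (zsss : List (List (List Entry))) (t : List (ℕ × List ℕ)) : ALit → List Γ'
  | ALit.a ν _ => KCNF.encodeLiteral (ν, false)
  | ALit.b i _ _ => depW ((zsss[i]?).getD []) ++ yLitW (((t[i]?).map Prod.snd).getD [])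

/-- The store during `vBuild`. [folklore] -/
def vbSt (S : RStore) (clw md blk iu2 tmp : List Γ') : RStore := fun r =>
  if r = kr KR.clw then clw else if r = kr KR.md then md else if r = kr KR.blk then blk else if r = kr KR.iu2 then iu2 else
  if r = tb TB.tmp then tmp else S r

section VbSt

variable (S : RStore) (clw md blk iu2 tmp w : List Γ')

/-- Reading `clw`. [folklore] -/
@[simp] theorem vbSt_clw : vbSt S clw md blk iu2 tmp (kr KR.clw) = clw := by simp [vbSt]
/-- Reading `md`. [folklore] -/
@[simp] theorem vbSt_md : vbSt S clw md blk iu2 tmp (kr KR.md) = md := by simp [vbSt]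
/-- Reading `blk`. [folklore] -/
@[simp] theorem vbSt_blk : vbSt S clw md blk iu2 tmp (kr KR.blk) = blk := by simp [vbSt]
/-- Reading `iu2`. [folklore] -/
@[simp] theorem vbSt_iu2 : vbSt S clw md blk iu2 tmp (kr KR.iu2) = iu2 := by simp [vbSt]
/-- Reading `tmp`. [folklore] -/
@[simp] theorem vbSt_tmp : vbSt S clw md blk iu2 tmp (tb TB.tmp) = tmp := by simp [vbSt]
/-- Reading any other register. [folklore] -/
theorem vbSt_other {r : Reg} (h0 : r ≠ kr KR.clw) (h1 : r ≠ kr KR.md) (h2 : r ≠ kr KR.blk) (h3 : r ≠ kr KR.iu2)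
    (h4 : r ≠ tb TB.tmp) : vbSt S clw md blk iu2 tmp r = S r := by simp [vbSt, h0, h1, h2, h3, h4]
/-- Reading a work register outside the family. [folklore] -/
theorem vbSt_kr {x : KR} (h0 : x ≠ KR.clw) (h1 : x ≠ KR.md) (h2 : x ≠ KR.blk) (h3 : x ≠ KR.iu2) :
    vbSt S clw md blk iu2 tmp (kr x) = S (kr x) := by
  apply vbSt_other <;> simp [h0, h1, h2, h3]
/-- Updating `clw`. [folklore] -/
@[simp] theorem update_vbSt_clw : Function.update (vbSt S clw md blk iu2 tmp) (kr KR.clw) w = vbSt S w md blk iu2 tmp := by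
  funext r; by_cases h : r = kr KR.clw
  · subst h; simp
  · rw [Function.update_of_ne h]; simp [vbSt, h]
/-- Updating `md`. [folklore] -/
@[simp] theorem update_vbSt_md : Function.update (vbSt S clw md blk iu2 tmp) (kr KR.md) w = vbSt S clw w blk iu2 tmp := by
  funext r; by_cases h : r = kr KR.md
  · subst h; simp
  · rw [Function.update_of_ne h]; simp [vbSt, h]
/-- Updating `blk`. [folklore] -/
@[simp] theorem update_vbSt_blk : Function.update (vbSt S clw md blk iu2 tmp) (kr KR.blk) w = vbSt S clw md w iu2 tmp := by
  funext r; by_cases h : r = kr KR.blk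
  · subst h; simp
  · rw [Function.update_of_ne h]; simp [vbSt, h]
/-- Updating `iu2`. [folklore] -/
@[simp] theorem update_vbSt_iu2 : Function.update (vbSt S clw md blk iu2 tmp) (kr KR.iu2) w = vbSt S clw md blk w tmp := by
  funext r; by_cases h : r = kr KR.iu2
  · subst h; simp
  · rw [Function.update_of_ne h]; simp [vbSt, h]
/-- Updating `tmp`. [folklore] -/
@[simp] theorem update_vbSt_tmp : Function.update (vbSt S clw md blk iu2 tmp) (tb TB.tmp) w = vbSt S clw md blk iu2 w := by
  funext r; by_cases h : r = tb TB.tmp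
  · subst h; simp
  · rw [Function.update_of_ne h]; simp [vbSt, h]

end VbSt

/-- The dependency word of a list of annotated literals. [folklore] -/
def vdepW (zsss : List (List (List Entry))) (t : List (ℕ × List ℕ)) (ls : List ALit) : List Γ' :=
  ls.flatMap (alDepW zsss t)

/-- What `vBuild` needs of the base store. [folklore] -/
structure VbBase (S : RStore) (zsss : List (List (List Entry))) (t : List (ℕ × List ℕ)) : Prop where
  /-- the block table -/
  bt : S (kr KR.bt) = wBT zsss
  /-- the `Y`-table -/
  yt : S (kr KR.yt) = wYT t
  /-- scratch -/
  t1 : S (kr KR.t1) = []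
  /-- scratch -/
  t2 : S (kr KR.t2) = []
  /-- scratch -/
  btw : S (kr KR.btw) = []
  /-- scratch -/
  md2 : S (kr KR.md2) = []
  /-- scratch -/
  ytw : S (kr KR.ytw) = []

/-- The per-symbol budget of `vBuild`. [folklore] -/
def vbK (zsss : List (List (List Entry))) (t : List (ℕ × List ℕ)) : ℕ := 20 * (wBT zsss).length + 22 * (wYT t).length + 24

section VbSpec

variable (S : RStore) (zsss : List (List (List Entry))) (t : List (ℕ × List ℕ)) (hV : VbBase S zsss t)
include hV

omit hV in
/-- Payload bits of an `A`-literal are emitted (mode `comma`). [folklore] -/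
theorem segRuns_vb_bits (blk iu2 : List Γ') : ∀ (u : List Bool) (rest tmp : List Γ'),
    SegRuns (kr KR.clw) vbBody (u.map Γ'.bit) (vbSt S (u.map Γ'.bit ++ rest) [Γ'.comma] blk iu2 tmp)
      (vbSt S rest [Γ'.comma] blk iu2 ((u.map Γ'.bit).reverse ++ tmp)) (6 * u.length)
  | [], rest, tmp => by simpa using SegRuns.nil (kr KR.clw) vbBody _
  | d :: u, rest, tmp => by
    have hbody : Runs (vbBody (Γ'.bit d)) (Function.update (vbSt S (Γ'.bit d :: (u.map Γ'.bit ++ rest)) [Γ'.comma] blk iu2 tmp)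
        (kr KR.clw) (u.map Γ'.bit ++ rest)) (vbSt S (u.map Γ'.bit ++ rest) [Γ'.comma] blk iu2 (Γ'.bit d :: tmp)) (2 + 2) := by
      rw [update_vbSt_clw]; unfold vbBody
      refine Runs.pop_cons (k := kr KR.md) (a := Γ'.comma) (w := []) (by simp) ?_
      rw [update_vbSt_md]
      exact ((Runs.push' (R' := vbSt S (u.map Γ'.bit ++ rest) [] blk iu2 (Γ'.bit d :: tmp)) (by simp)).seq
        (Runs.push' (by simp))).of_eq rfl (by norm_num)
    have ih := segRuns_vb_bits blk iu2 u rest (Γ'.bit d :: tmp)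
    have hk : vbSt S (Γ'.bit d :: (u.map Γ'.bit ++ rest)) [Γ'.comma] blk iu2 tmp (kr KR.clw) = Γ'.bit d :: (u.map Γ'.bit ++ rest) := by
      simp
    refine (SegRuns.cons hk hbody ih).cast (by simp) (by simp) (by simp) ?_
    simp only [List.length_cons]; omega

omit hV in
/-- **An `A`-literal**: its literal with polarity `false` is emitted. [folklore] -/
theorem segRuns_vb_alitA (ν : ℕ) (p : Bool) (rest tmp : List Γ') :
    SegRuns (kr KR.clw) vbBody (wALit (ALit.a ν p)) (vbSt S (wALit (ALit.a ν p) ++ rest) [] [] [] tmp)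
      (vbSt S rest [] [] [] ((KCNF.encodeLiteral (ν, false)).reverse ++ tmp)) (vbK zsss t * (wALit (ALit.a ν p)).length) := by
  have hw : wALit (ALit.a ν p) = Γ'.bit p :: Γ'.bit false :: ((encodeNat ν).map Γ'.bit ++ [Γ'.comma]) := rfl
  have hlit : KCNF.encodeLiteral (ν, false) = Γ'.bit false :: ((encodeNat ν).map Γ'.bit ++ [Γ'.comma]) := rfl
  rw [hw, hlit]
  set u := (encodeNat ν).map Γ'.bit with hu
  have h1 : Runs (vbBody (Γ'.bit p)) (Function.update (vbSt S (Γ'.bit p :: Γ'.bit false :: (u ++ [Γ'.comma]) ++ rest) [] [] [] tmp)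
      (kr KR.clw) (Γ'.bit false :: (u ++ [Γ'.comma]) ++ rest))
      (vbSt S (Γ'.bit false :: (u ++ [Γ'.comma]) ++ rest) [Γ'.blank] [] [] tmp) (1 + 2) := by
    rw [update_vbSt_clw]; unfold vbBody
    exact Runs.pop_nil (by simp) (Runs.push' (by simp))
  have h2 : Runs (vbBody (Γ'.bit false)) (Function.update (vbSt S (Γ'.bit false :: (u ++ [Γ'.comma]) ++ rest) [Γ'.blank] [] [] tmp)
      (kr KR.clw) (u ++ [Γ'.comma] ++ rest)) (vbSt S (u ++ [Γ'.comma] ++ rest) [Γ'.comma] [] [] (Γ'.bit false :: tmp)) (2 + 2) := by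
    rw [update_vbSt_clw]; unfold vbBody
    refine Runs.pop_cons (k := kr KR.md) (a := Γ'.blank) (w := []) (by simp) ?_
    rw [update_vbSt_md]
    exact ((Runs.push' (R' := vbSt S (u ++ [Γ'.comma] ++ rest) [] [] [] (Γ'.bit false :: tmp)) (by simp)).seq
      (Runs.push' (by simp))).of_eq rfl (by norm_num)
  have h3 := segRuns_vb_bits S [] [] (encodeNat ν) ([Γ'.comma] ++ rest) (Γ'.bit false :: tmp)
  rw [← hu] at h3
  have h4 : Runs (vbBody Γ'.comma) (Function.update (vbSt S ([Γ'.comma] ++ rest) [Γ'.comma] [] [] (u.reverse ++ Γ'.bit false :: tmp))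
      (kr KR.clw) rest) (vbSt S rest [] [] [] (Γ'.comma :: (u.reverse ++ Γ'.bit false :: tmp))) (1 + 2) := by
    rw [update_vbSt_clw]; unfold vbBody
    refine Runs.pop_cons (k := kr KR.md) (a := Γ'.comma) (w := []) (by simp) ?_
    rw [update_vbSt_md]; exact Runs.push' (by simp)
  have hk1 : vbSt S (Γ'.bit p :: Γ'.bit false :: (u ++ [Γ'.comma]) ++ rest) [] [] [] tmp (kr KR.clw) =
      Γ'.bit p :: (Γ'.bit false :: (u ++ [Γ'.comma]) ++ rest) := by simp
  have hk2 : vbSt S (Γ'.bit false :: (u ++ [Γ'.comma]) ++ rest) [Γ'.blank] [] [] tmp (kr KR.clw) = Γ'.bit false :: (u ++ [Γ'.comma] ++ rest) := by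
    simp
  have hk4 : vbSt S ([Γ'.comma] ++ rest) [Γ'.comma] [] [] (u.reverse ++ Γ'.bit false :: tmp) (kr KR.clw) = Γ'.comma :: rest := by simp
  have h34 := h3.append (SegRuns.single hk4 h4)
  have := SegRuns.cons hk1 h1 (SegRuns.cons hk2 h2 (h34.cast rfl (by simp) rfl le_rfl))
  refine this.cast (by simp) rfl (by simp) ?_
  have : u.length = (encodeNat ν).length := by simp [hu]
  simp only [List.length_cons, List.length_append, List.length_nil, vbK]; nlinarith

omit hV in
/-- Payload kets of a `B`-literal go to `blk` and `iu2` (mode `ket`). [folklore] -/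
theorem segRuns_vb_kets (tmp : List Γ') : ∀ (n : ℕ) (rest blk iu2 : List Γ'),
    SegRuns (kr KR.clw) vbBody (List.replicate n Γ'.ket) (vbSt S (List.replicate n Γ'.ket ++ rest) [Γ'.ket] blk iu2 tmp)
      (vbSt S rest [Γ'.ket] (ticks Γ'.blank n ++ blk) (ticks Γ'.blank n ++ iu2) tmp) (7 * n)
  | 0, rest, blk, iu2 => by simpa using SegRuns.nil (kr KR.clw) vbBody _
  | n + 1, rest, blk, iu2 => by
    have hbody : Runs (vbBody Γ'.ket) (Function.update (vbSt S (Γ'.ket :: (List.replicate n Γ'.ket ++ rest)) [Γ'.ket] blk iu2 tmp)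
        (kr KR.clw) (List.replicate n Γ'.ket ++ rest))
        (vbSt S (List.replicate n Γ'.ket ++ rest) [Γ'.ket] (Γ'.blank :: blk) (Γ'.blank :: iu2) tmp) (3 + 2) := by
      rw [update_vbSt_clw]; unfold vbBody
      refine Runs.pop_cons (k := kr KR.md) (a := Γ'.ket) (w := []) (by simp) ?_
      rw [update_vbSt_md]
      exact ((Runs.push' (R' := vbSt S (List.replicate n Γ'.ket ++ rest) [] (Γ'.blank :: blk) iu2 tmp) (by simp)).seq
        ((Runs.push' (R' := vbSt S (List.replicate n Γ'.ket ++ rest) [] (Γ'.blank :: blk) (Γ'.blank :: iu2) tmp) (by simp)).seq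
        (Runs.push' (by simp)))).of_eq rfl (by norm_num)
    have ih := segRuns_vb_kets tmp n rest (Γ'.blank :: blk) (Γ'.blank :: iu2)
    have hk : vbSt S (Γ'.ket :: (List.replicate n Γ'.ket ++ rest)) [Γ'.ket] blk iu2 tmp (kr KR.clw) = Γ'.ket :: (List.replicate n Γ'.ket ++ rest) := by
      simp
    refine (SegRuns.cons hk hbody ih).cast (by simp [List.replicate_succ]) (by simp [List.replicate_succ]) ?_ (by omega)
    simp only [ticks, replicate_append_cons, List.replicate_succ, List.cons_append]

omit hV in
/-- Payload bras of a `B`-literal are dropped (mode `ket`). [folklore] -/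
theorem segRuns_vb_bras (blk iu2 tmp : List Γ') : ∀ (n : ℕ) (rest : List Γ'),
    SegRuns (kr KR.clw) vbBody (List.replicate n Γ'.bra) (vbSt S (List.replicate n Γ'.bra ++ rest) [Γ'.ket] blk iu2 tmp)
      (vbSt S rest [Γ'.ket] blk iu2 tmp) (5 * n)
  | 0, rest => by simpa using SegRuns.nil (kr KR.clw) vbBody _
  | n + 1, rest => by
    have hbody : Runs (vbBody Γ'.bra) (Function.update (vbSt S (Γ'.bra :: (List.replicate n Γ'.bra ++ rest)) [Γ'.ket] blk iu2 tmp)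
        (kr KR.clw) (List.replicate n Γ'.bra ++ rest)) (vbSt S (List.replicate n Γ'.bra ++ rest) [Γ'.ket] blk iu2 tmp) (1 + 2) := by
      rw [update_vbSt_clw]; unfold vbBody
      refine Runs.pop_cons (k := kr KR.md) (a := Γ'.ket) (w := []) (by simp) ?_
      rw [update_vbSt_md]; exact Runs.push' (by simp)
    have ih := segRuns_vb_bras blk iu2 tmp n rest
    have hk : vbSt S (Γ'.bra :: (List.replicate n Γ'.bra ++ rest)) [Γ'.ket] blk iu2 tmp (kr KR.clw) = Γ'.bra :: (List.replicate n Γ'.bra ++ rest) := by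
      simp
    refine (SegRuns.cons hk hbody ih).cast (by simp [List.replicate_succ]) (by simp [List.replicate_succ]) rfl (by omega)

/-- **A `B`-literal**: the dependency literals and the renaming literals of its block are emitted.
[folklore] -/
theorem segRuns_vb_alitB (i j : ℕ) (p : Bool) (rest tmp : List Γ') (hi : i < zsss.length) (hit : i < t.length) :
    SegRuns (kr KR.clw) vbBody (wALit (ALit.b i j p)) (vbSt S (wALit (ALit.b i j p) ++ rest) [] [] [] tmp)
      (vbSt S rest [] [] [] ((depW zsss[i] ++ yLitW (t[i]).2).reverse ++ tmp)) (vbK zsss t * (wALit (ALit.b i j p)).length) := by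
  have hw : wALit (ALit.b i j p) = Γ'.bit p :: Γ'.bit true :: (List.replicate i Γ'.ket ++ List.replicate j Γ'.bra ++ [Γ'.comma]) := rfl
  rw [hw]
  have h1 : Runs (vbBody (Γ'.bit p)) (Function.update (vbSt S (Γ'.bit p :: Γ'.bit true :: (List.replicate i Γ'.ket ++ List.replicate j Γ'.bra
      ++ [Γ'.comma]) ++ rest) [] [] [] tmp) (kr KR.clw) (Γ'.bit true :: (List.replicate i Γ'.ket ++ List.replicate j Γ'.bra ++ [Γ'.comma]) ++ rest))
      (vbSt S (Γ'.bit true :: (List.replicate i Γ'.ket ++ List.replicate j Γ'.bra ++ [Γ'.comma]) ++ rest) [Γ'.blank] [] [] tmp) (1 + 2) := by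
    rw [update_vbSt_clw]; unfold vbBody
    exact Runs.pop_nil (by simp) (Runs.push' (by simp))
  have h2 : Runs (vbBody (Γ'.bit true)) (Function.update (vbSt S (Γ'.bit true :: (List.replicate i Γ'.ket ++ List.replicate j Γ'.bra
      ++ [Γ'.comma]) ++ rest) [Γ'.blank] [] [] tmp) (kr KR.clw) (List.replicate i Γ'.ket ++ List.replicate j Γ'.bra ++ [Γ'.comma] ++ rest))
      (vbSt S (List.replicate i Γ'.ket ++ List.replicate j Γ'.bra ++ [Γ'.comma] ++ rest) [Γ'.ket] [] [] tmp) (1 + 2) := by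
    rw [update_vbSt_clw]; unfold vbBody
    refine Runs.pop_cons (k := kr KR.md) (a := Γ'.blank) (w := []) (by simp) ?_
    rw [update_vbSt_md]; exact Runs.push' (by simp)
  have h3 := segRuns_vb_kets S tmp i (List.replicate j Γ'.bra ++ [Γ'.comma] ++ rest) [] []
  simp only [List.append_nil] at h3
  have h4 := segRuns_vb_bras S (ticks Γ'.blank i) (ticks Γ'.blank i) tmp j ([Γ'.comma] ++ rest)
  have h5 : Runs (vbBody Γ'.comma) (Function.update (vbSt S ([Γ'.comma] ++ rest) [Γ'.ket] (ticks Γ'.blank i) (ticks Γ'.blank i) tmp)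
      (kr KR.clw) rest) (vbSt S rest [] [] [] ((depW zsss[i] ++ yLitW (t[i]).2).reverse ++ tmp))
      ((20 * (wBT zsss).length + 11) + (22 * (wYT t).length + 11) + 2) := by
    rw [update_vbSt_clw]; unfold vbBody
    refine Runs.pop_cons (k := kr KR.md) (a := Γ'.ket) (w := []) (by simp) ?_
    rw [update_vbSt_md]
    set X := vbSt S rest [] (ticks Γ'.blank i) (ticks Γ'.blank i) tmp with hX
    have hv := runs_vEmitBlock' X zsss i hi (by rw [hX, vbSt_kr] <;> first | exact hV.bt | decide) (by simp [hX])
      (by rw [hX, vbSt_kr] <;> first | exact hV.t1 | decide) (by rw [hX, vbSt_kr] <;> first | exact hV.t2 | decide)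
      (by rw [hX, vbSt_kr] <;> first | exact hV.btw | decide) (by rw [hX, vbSt_kr] <;> first | exact hV.md2 | decide)
    have eX : Function.update (Function.update X (kr KR.blk) []) (tb TB.tmp) ((depW zsss[i]).reverse ++ X (tb TB.tmp)) =
        vbSt S rest [] [] (ticks Γ'.blank i) ((depW zsss[i]).reverse ++ tmp) := by
      rw [hX]; simp
    rw [eX] at hv
    set Y := vbSt S rest [] [] (ticks Γ'.blank i) ((depW zsss[i]).reverse ++ tmp) with hY
    have hy := runs_yEmit' Y t i hit (by rw [hY, vbSt_kr] <;> first | exact hV.yt | decide) (by simp [hY])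
      (by rw [hY, vbSt_kr] <;> first | exact hV.t1 | decide) (by rw [hY, vbSt_kr] <;> first | exact hV.t2 | decide)
      (by rw [hY, vbSt_kr] <;> first | exact hV.ytw | decide) (by rw [hY, vbSt_kr] <;> first | exact hV.md2 | decide)
    refine (hv.seq hy).of_eq ?_ le_rfl
    rw [hY]; simp
  have hk1 : vbSt S (Γ'.bit p :: Γ'.bit true :: (List.replicate i Γ'.ket ++ List.replicate j Γ'.bra ++ [Γ'.comma]) ++ rest) [] [] [] tmp
      (kr KR.clw) = Γ'.bit p :: (Γ'.bit true :: (List.replicate i Γ'.ket ++ List.replicate j Γ'.bra ++ [Γ'.comma]) ++ rest) := by simp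
  have hk2 : vbSt S (Γ'.bit true :: (List.replicate i Γ'.ket ++ List.replicate j Γ'.bra ++ [Γ'.comma]) ++ rest) [Γ'.blank] [] [] tmp
      (kr KR.clw) = Γ'.bit true :: (List.replicate i Γ'.ket ++ List.replicate j Γ'.bra ++ [Γ'.comma] ++ rest) := by simp
  have hk5 : vbSt S ([Γ'.comma] ++ rest) [Γ'.ket] (ticks Γ'.blank i) (ticks Γ'.blank i) tmp (kr KR.clw) = Γ'.comma :: rest := by simp
  have h45 := h4.append (SegRuns.single hk5 h5)
  have h345 := h3.append (h45.cast rfl (by simp) rfl le_rfl)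
  have := SegRuns.cons hk1 h1 (SegRuns.cons hk2 h2 (h345.cast rfl (by simp) rfl le_rfl))
  refine this.cast (by simp) rfl rfl ?_
  simp only [List.length_cons, List.length_append, List.length_replicate, List.length_nil, vbK]
  nlinarith

/-- **A run of annotated literals.** [folklore] -/
theorem segRuns_vb_alits : ∀ (ls : List ALit) (rest tmp : List Γ'), (∀ al ∈ ls, al.WF zsss t) →
    SegRuns (kr KR.clw) vbBody (ls.flatMap wALit) (vbSt S (ls.flatMap wALit ++ rest) [] [] [] tmp)
      (vbSt S rest [] [] [] ((vdepW zsss t ls).reverse ++ tmp)) (vbK zsss t * (ls.flatMap wALit).length)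
  | [], rest, tmp, _ => by simpa [vdepW] using SegRuns.nil (kr KR.clw) vbBody _
  | al :: ls, rest, tmp, hwf => by
    have hal := hwf al (by simp)
    have hrest : ∀ al' ∈ ls, al'.WF zsss t := fun al' h => hwf al' (by simp [h])
    have h1 : SegRuns (kr KR.clw) vbBody (wALit al) (vbSt S (wALit al ++ (ls.flatMap wALit ++ rest)) [] [] [] tmp)
        (vbSt S (ls.flatMap wALit ++ rest) [] [] [] ((alDepW zsss t al).reverse ++ tmp)) (vbK zsss t * (wALit al).length) := by
      cases al with
      | a ν p => exact segRuns_vb_alitA S zsss t ν p _ tmp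
      | b i j p =>
        obtain ⟨hit, hi, -⟩ := hal
        have := segRuns_vb_alitB S zsss t hV i j p (ls.flatMap wALit ++ rest) tmp hi hit
        refine this.cast rfl rfl ?_ le_rfl
        simp [alDepW, List.getElem?_eq_getElem hi, List.getElem?_eq_getElem hit]
    have h2 := segRuns_vb_alits ls rest ((alDepW zsss t al).reverse ++ tmp) hrest
    have := h1.append h2
    refine this.cast (by simp) (by simp) (by simp [vdepW]) ?_
    simp only [List.flatMap_cons, List.length_append]; ring_nf; omega

/-- **Specification of `vBuild`.** [folklore] -/
theorem runs_vBuild (ls : List ALit) (hwf : ∀ al ∈ ls, al.WF zsss t) (hcl : S (kr KR.cl) = ls.flatMap wALit)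
    (hclw : S (kr KR.clw) = []) (hmd : S (kr KR.md) = []) (hblk : S (kr KR.blk) = []) (hiu2 : S (kr KR.iu2) = [])
    (htmp : S (tb TB.tmp) = []) (hvt : S (tb TB.vt) = []) :
    Runs vBuild S (Function.update S (tb TB.vt) (vdepW zsss t ls))
      ((vbK zsss t + 10) * (ls.flatMap wALit).length + 3 * (vdepW zsss t ls).length + 5) := by
  have e : vbSt S [] [] [] [] [] = S := by
    funext r
    by_cases h0 : r = kr KR.clw; · subst h0; simp [hclw]
    by_cases h1 : r = kr KR.md; · subst h1; simp [hmd]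
    by_cases h2 : r = kr KR.blk; · subst h2; simp [hblk]
    by_cases h3 : r = kr KR.iu2; · subst h3; simp [hiu2]
    by_cases h4 : r = tb TB.tmp; · subst h4; simp [htmp]
    rw [vbSt_other _ _ _ _ _ _ h0 h1 h2 h3 h4]
  unfold vBuild
  have h0 := runs_copyToG (a := kr KR.cl) (b := kr KR.clw) (t₁ := kr KR.t1) (t₂ := kr KR.t2)
    (by simp) (by simp) (by simp) (by simp) (by simp) (by simp) S hV.t1 hV.t2 hclw
  rw [hcl] at h0
  have h0' : Runs (copyToG (kr KR.cl) (kr KR.clw) (kr KR.t1) (kr KR.t2)) S (vbSt S (ls.flatMap wALit) [] [] [] [])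
      (10 * (ls.flatMap wALit).length + 3) := by
    refine h0.of_eq ?_ le_rfl
    conv_lhs => rw [← e]
    rw [update_vbSt_clw]
  have h1 := (segRuns_vb_alits S zsss t hV ls [] [] hwf).runs_loop_nil (by simp)
  simp only [List.append_nil] at h1
  have h2 := runs_pour (a := tb TB.tmp) (b := tb TB.vt) (by simp) (vbSt S [] [] [] [] (vdepW zsss t ls).reverse)
  have evt : vbSt S [] [] [] [] (vdepW zsss t ls).reverse (tb TB.vt) = [] := by
    rw [vbSt_other] <;> first | exact hvt | simp
  rw [vbSt_tmp, evt, List.length_reverse, List.reverse_reverse, List.append_nil, update_vbSt_tmp] at h2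
  refine (h0'.seq (h1.seq h2)).of_eq ?_ (by nlinarith)
  rw [e]

end VbSpec

/-! ### The dependency word of an annotated clause is the literal list of `depClause` -/

/-- The all-false tuple zipped with `V` is `V` with polarity `false`. [folklore] -/
theorem zip_replicate_false (V : List ℕ) : V.zip (List.replicate V.length false) = V.map fun v => (v, false) := by
  induction V with
  | nil => rfl
  | cons v V ih => simp [List.replicate_succ, ih]

/-- **The dependency word of the annotation of a clause** is the clause body of its dependency list
with the all-false tuple. [folklore] -/
theorem vdepW_eq (P : Params) (F : List (List (ℕ × Bool))) (c : List (ℕ × Bool)) :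
    vdepW (btab P F) (ytab P F) (c.map (annLit P F)) = cbody ((depClause P F c).map fun v => (v, false)) := by
  unfold vdepW depClause
  rw [List.flatMap_map, List.map_flatMap, cbody, List.flatMap_assoc]
  refine List.flatMap_congr fun l _ => ?_
  unfold annLit depVar
  by_cases hB : inB P F l.1 = true
  · rw [if_pos hB, if_pos hB]
    have hx := (mem_bList P F).2 hB
    have hiN := blockOf_lt_numNB P F hx
    simp only [alDepW]
    have hbt : (btab P F)[blockOf P F l.1]? = some ((block P F (blockOf P F l.1)).map (entries P F)) := by
      unfold btab; rw [List.getElem?_map, List.getElem?_range hiN]; rfl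
    have hyt : (ytab P F)[blockOf P F l.1]? =
        some (fAt P F (blockOf P F l.1), (List.range (ycount P F (blockOf P F l.1))).map (newIdxY P F (blockOf P F l.1))) := by
      unfold ytab; rw [List.getElem?_map, List.getElem?_range hiN]; rfl
    rw [hbt, hyt]
    simp only [Option.getD_some, Option.map_some, depBlock, List.map_append, List.flatMap_append]
    congr 1
    · rw [depW_eq, depTheta_eq, cbody]
    · simp [yLitW, List.flatMap_map]
  · rw [if_neg hB, if_neg hB]
    simp [alDepW]

end Literature.Computability.FineGrained.IPRenameM
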